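import Literature.AlgebraicGeometry.Kloosterman2023.HilbertFunctionFormula
import Literature.AlgebraicGeometry.Kloosterman2025.TwoPlanesNormalForm
import Literature.AlgebraicGeometry.Kloosterman2025.QuarticTwoPlanesDegeneration
import Literature.AlgebraicGeometry.Kloosterman2025.CubicTwoPlanesDegeneration
import Literature.RingTheory.MvPolynomial.VariableIdeals
import HarnessLib

/-!
# Kloosterman 2025, §6: the flat limits of the three degenerations — the limit ideals as intersections of their
# printed components, and "the Hilbert functions of `I^{(0)}` and `I^{(t)}` coincide"

R. Kloosterman, *On a conjecture on Hodge loci of linear combinations of linear subvarieties*, Rend. Circ. Mat.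
Palermo (2) 74 (2025) = arXiv:2312.12363, §6 "Examples satisfying Movasati's conjecture" (text read: arXiv v2, pp. 16–17)
[cite: Kloosterman2025, Prop. 6.1, Prop. 6.4, Remark 6.7]. The tree files `QuarticTwoPlanesDegeneration.lean` (Prop. 6.1)
and `CubicTwoPlanesDegeneration.lean` (Prop. 6.4 / Rem. 6.7) prove the ring identities of these proofs (`f_t ∈ I^{(t)}`,
the limit generators are specialisations of elements of `I^{(t)}`, the limit ideal is CONTAINED in each printed
component) and record verbatim: "What is NOT formalised here: flatness of `V(I^{(t)})` at `t = 0` (equality of Hilbert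
functions) …". This file proves that step, for every `k`, as printed:

* **Prop. 6.1** (`d = 4`, `c = 2`; `Π₁ = V(x₀,x₁,x_{k+3},…,x_{2k+1})`, `Π₂ = V(x₂,x₃,x_{k+3},…,x_{2k+1})`,
  `I^{(t)} = ⟨x₀x₂ + tQ₁₃, x₁x₂ − tQ₀₃, x_{k+3}, …, x_{2k+1}⟩`, `I^{(0)} = ⟨x₀x₂, x₁x₂, x₁Q₁₃ + x₀Q₀₃, x_{k+3}, …⟩`).
  Printed: "Then each of the generator is a specialization to `t = 0` of an element for `I^{(t)}`. Moreover, one easily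
  checks that the Hilbert functions of `I^{(0)}` and `I^{(t)}` coincide. Hence `Y_t = V(I^{(t)})` is a flat family.
  Moreover, `V(x₀x₂, x₁x₂, x₁Q₁₃ + x₀Q₀₃) = V(x₂, x₁Q₁₃ + x₀Q₀₃) ∪ V(x₀, x₁)`. Hence `Y_0` is the union of `Π₁` and
  `k`-dimensional subscheme whose class is `h^k − [Π₂]`."
  PROVED: `quarticLimitIdeal_eq_inf` — the IDEAL identity `I^{(0)} = ⟨x₀, x₁, x_T⟩ ∩ (⟨x₂, x_T⟩ + ⟨L⟩)`,
  `L = x₁Q₁₃ + x₀Q₀₃`, for all `Q₀₃, Q₁₃` (the set-theoretic display, scheme-theoretically);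
  `hilbert_quarticLimitIdeal`, `hilbert_quarticFibreIdeal` — both Hilbert functions in closed form; and
  **`hilbert_quarticFibreIdeal_eq_hilbert_quarticLimitIdeal`: `h_{I^{(t)}}(m) = h_{I^{(0)}}(m)` for every `m`**, under
  exactly the complete-intersection hypotheses the printed argument uses ("`Y_t` is a complete intersection of
  multidegree `(2,2,1,…,1)`": `q₁ = x₀x₂ + tQ₁₃ ∉ ⟨x_T⟩` and `q₂ = x₁x₂ − tQ₀₃` a non-zero-divisor modulo `⟨x_T, q₁⟩`;
  and the residual cubic `V(x₂, L, x_T)` of the expected dimension: `L ∉ ⟨x₂, x_T⟩`) — the binomial identity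
  `(1 − s²)² = (1 − s)² + (1 − s)(1 − s³) − (1 − s)³` over `(1 − s)^{k+3}`. Also `span_quartic_X_sup_eq` /
  `span_X_mul_L_sup_eq_inf`: `⟨f₀, x₂, x_T⟩ = ⟨x₃L, x₂, x_T⟩ = ⟨x₂, x₃, x_T⟩ ∩ ⟨x₂, L, x_T⟩` for `f₀` in the normal form
  of the tree's `quarticNormalForm` (the hyperplane section `X ∩ V(x₂, x_T) = Π₂ ∪ V(x₂, L, x_T)` behind "whose class is
  `h^k − [Π₂]`"), when `L ∉ ⟨x₂, x₃, x_T⟩`. Printed coordinates: `prop_6_1_hilbert_fibre_eq_hilbert_limit` (`k ≥ 1`;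
  common value `χ_{k+3}(m) − 2χ_{k+3}(m−2) + χ_{k+3}(m−4) = koszulHilbert (2k+2) (2,2,1^{k−1}) m`, Kloosterman 2023
  eq. (1) [cite: Kloosterman2023, §2 eq. (1)]).
* **Prop. 6.4** (`d = c = 3`; the `G(2,5)`-cone degeneration; `I^{(0)} = ⟨p₁, p₂, x₀x₃, x₁x₃, x₂x₃⟩`). Printed: "This is
  the intersection of two complete intersection ideals `⟨p₁, p₂, x₃⟩` and `⟨x₀, x₁, x₂⟩` and each of the generators is
  the specialization to `t = 0` of an element in `I^{(t)}`. Moreover, one easily checks that the Hilbert function of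
  `I^{(0)}` coincide with the Hilbert function of `I^{(t)}` for `t ≠ 0`." PROVED: `cubicLimitIdeal_eq_inf` (the ideal
  identity, for all `p₁, p₂ ∈ ⟨x₀, x₁, x₂⟩`), `hilbert_cubicLimitIdeal` and
  **`hilbert_cubicLimitIdeal_eq_grassmannSection`**: if `⟨x₃, x_T, p₁, p₂⟩` is a complete intersection then
  `h_{I^{(0)}}(m) = χ_{k+1}(m) + 3χ_{k+1}(m−1) + χ_{k+1}(m−2)`, Hilbert series `(1 + 3s + s²)/(1 − s)^{k+1}` — the Hilbert
  function of a `k`-dimensional linear section of the cone over the Plücker-embedded `G(2,5) ⊂ ℙ⁹` (`h`-vector `(1,3,1)`,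
  degree `5`). Printed coordinates: `prop_6_4_hilbert_limit` (`k ≥ 2`), `plucker_subst_mem_span`.
* **Remark 6.7** (the `L₀₃ = 0` variant: `2 × 2` minors of `A_t`, a quartic scroll). Printed: "The limit for `I_t` when
  `t → 0` is generated by `x₀x₃, x₀x₄, x₁x₃, x₁x₄, x₀L₀₅ + x₁L₁₅, x₃L₂₃ + x₄L₂₄`, which is the intersection of
  `(x₀, x₁, x₃L₂₃ + x₄L₂₄)` and `(x₃, x₄, x₀L₀₅ + x₁L₁₅)`." PROVED: `scrollLimitIdeal_eq_inf` (for all `N ∈ ⟨x₀,x₁⟩`,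
  `M ∈ ⟨x₃,x₄⟩`), `hilbert_scrollLimitIdeal` and **`hilbert_scrollLimitIdeal_eq_scrollSection`**:
  `h(m) = χ_{k+1}(m) + 3χ_{k+1}(m−1)`, Hilbert series `(1 + 3s)/(1 − s)^{k+1}` (degree `4`), when the two quadric cones are
  complete intersections. Printed coordinates: `remark_6_7_hilbert_limit` (`k ≥ 2`).

Everything is stated in `ℙ^n` over any field `K` with an arbitrary finite set `T` of tail coordinates and arbitrary distinct
indices off `T` (the printed case is `n = 2k+1`, `T = {k+3,…,2k+1}` resp. `{k+4,…,2k+1}`, §7 `tailVars`); Hilbert functions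
are the tree's `dim_K S_m − dim_K I_m` (`idealDegree`, `HomogeneousHilbertFunction.lean`), values in Kloosterman's
`χ_v(m) = binom(m+v−1, v−1)` (`Kloosterman2023.chi`, `= 0` for `m < 0`).

TOOLS (§1–§2, reusable): Pascal's rule `χ_{v+1}(m) − χ_{v+1}(m−1) = χ_v(m)`; **`koszulHilbert_succ_concat_one` /
`koszulHilbert_add_append_replicate_one`** — a linear form in a regular sequence kills a variable in Kloosterman's eq. (1)
(`koszulHilbert (v+j) (l ++ 1^j) = koszulHilbert v l`); `koszulHilbert_two_two`; **`hilbert_span_X_image_eq_chi`** — the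
Hilbert function `χ_{n+1−|C|}` of a coordinate subspace `V(x_C) ⊂ ℙ^n`, by induction on `C` through the non-zero-divisor
formula (tree `hilbert_sup_span_eq_sub`, [cite: Philippon1986, Lemme 3.1]) and the primality of `(x_C)` (tree
`isPrime_span_X_image`); the lattice identity `h_{I∩J} = h_I + h_J − h_{I+J}` (tree `hilbert_inf_add_hilbert_sup`) and the
monomial intersection `(x_A,x_C) ∩ (x_B,x_C) = (x_C) + (x_a x_b)` (tree `span_X_inf_span_X_eq`).

§8 puts the complete-intersection hypotheses in checkable (UFD) form: for Prop. 6.1, with `Q₀₃, Q₁₃` not involving the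
tail coordinates (printed: "`Q_{ij} ∈ ℂ[x₀, …, x_{k+2}]_2`", i.e. `vars Q ⊆ {0, …, k+2}`), it suffices that
`q₁ = x₀x₂ + tQ₁₃ ≠ 0` be relatively prime to `q₂ = x₁x₂ − tQ₀₃` (`IsRelPrime` in the UFD `K[x]`) and that `x₂ ∤ L`
(`hilbert_quarticFibreIdeal_eq_hilbert_quarticLimitIdeal_of_isRelPrime`, `prop_6_1_hilbert_fibre_eq_hilbert_limit_of_isRelPrime`);
for Prop. 6.4, that the restrictions `p̄ᵢ = pᵢ|_{x₃ = x_T = 0}` (the tree's `killVars`) satisfy `p̄₁ ≠ 0`, `p̄₁, p̄₂` coprime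
(`hilbert_cubicLimitIdeal_eq_grassmannSection_of_isRelPrime`, `prop_6_4_hilbert_limit_of_isRelPrime`) — coprime restrictions
make `x_s, q₁, q₂` a regular sequence (`mem_sup_span_of_isRelPrime`).

What is NOT formalised: the Hilbert function of the GENERAL fibre in Prop. 6.4 and Rem. 6.7 (the postulation of the
Plücker ideal of `G(2,5)`, resp. of the `2 × 2` minors of a `2 × 4` matrix — straightening law / Eagon–Northcott), so for
those two only the `I^{(0)}` side of "the Hilbert functions coincide" is certified (its value IS the classical one);
flatness as a statement about the `K[t]`-module `K[t][x]/I`; irreducibility of `Y_t`; the cycle classes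
`[Y_0]_prim = [Π₁]_prim − [Π₂]_prim`, `[Y_0] = [Π₁] + [Π₂] + h^k`; Cor. 6.2 / 6.5. No named facts; 0 sorry.

HONEST FRAMING (cell pub-hlocus): certified instances and evidence bearing on the general Hodge conjecture; no claim.

## References

* [Kloosterman2025] R. Kloosterman, *On a conjecture on Hodge loci of linear combinations of linear subvarieties*,
  Rend. Circ. Mat. Palermo (2) 74 (2025); arXiv:2312.12363, §6: Prop. 6.1, Cor. 6.2, Prop. 6.4, Cor. 6.5, Remark 6.7.
* [Kloosterman2023] R. Kloosterman, *Variational Hodge conjecture for complete intersections on hypersurfaces in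
  projective space*, Rend. Sem. Mat. Univ. Padova 148 (2023), §2 eq. (1).
* [Philippon1986] P. Philippon, *Lemmes de zéros dans les groupes algébriques commutatifs*, Bull. SMF 114 (1986),
  Lemme 3.1.
-/

noncomputable section

open MvPolynomial Module
open Literature.RingTheory.MvPolynomial Literature.AlgebraicGeometry.Kloosterman2023

attribute [local instance] MvPolynomial.gradedAlgebra

namespace Literature.AlgebraicGeometry.Kloosterman2025

universe u

/-! ## §1 Binomial bookkeeping: `χ_v`, Pascal's rule, and linear forms in the Koszul alternating sum -/

section Combinatorics

/-- **Pascal's rule for `χ`**: `χ_{v+1}(m) − χ_{v+1}(m−1) = χ_v(m)` for `v ≥ 1` and every integer `m` (a hyperplane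
section of `ℙ^v` is `ℙ^{v−1}`: `binom(m+v,v) − binom(m+v−1,v) = binom(m+v−1,v−1)`, and both sides vanish for `m < 0`).
[folklore] -/
private theorem chi_succ_sub_chi_succ_pred {v : ℕ} (hv : 1 ≤ v) (m : ℤ) :
    chi (v + 1) m - chi (v + 1) (m - 1) = chi v m := by
  rcases lt_trichotomy m 0 with hm | rfl | hm
  · rw [chi_of_neg _ hm, chi_of_neg _ (by omega), chi_of_neg _ hm, sub_zero]
  · rw [chi_of_neg _ (by norm_num : (0 : ℤ) - 1 < 0), sub_zero]
    unfold chi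
    simp only [le_refl, if_true, Int.toNat_zero, zero_add]
    rw [Nat.add_sub_cancel, Nat.choose_self, Nat.choose_self]
  · obtain ⟨j, rfl⟩ : ∃ j : ℕ, m = (j : ℤ) + 1 := ⟨(m - 1).toNat, by omega⟩
    have e1 : ((j : ℤ) + 1 - 1) = (j : ℤ) := by ring
    rw [e1, show ((j : ℤ) + 1) = ((j + 1 : ℕ) : ℤ) by push_cast; ring]
    obtain ⟨w, rfl⟩ : ∃ w, v = w + 1 := ⟨v - 1, by omega⟩
    rw [chi_natCast, chi_natCast, chi_natCast]
    -- binom(j+1+w+1, w+1) = binom(j+w+1, w) + binom(j+w+1, w+1)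
    have e2 : j + 1 + (w + 1) = (j + w + 1) + 1 := by ring
    have e3 : j + (w + 1) = j + w + 1 := by ring
    have e4 : j + 1 + w = j + w + 1 := by ring
    rw [e2, e3, e4, Nat.choose_succ_succ']
    push_cast
    ring

/-- `Σ f − Σ g = Σ (f − g)` along one list. [folklore] -/
private theorem list_sum_map_sub_sum_map {α : Type*} (l : List α) (f g : α → ℤ) :
    (l.map f).sum - (l.map g).sum = (l.map fun x => f x - g x).sum := by
  induction l with
  | nil => simp
  | cons a l ih => simp only [List.map_cons, List.sum_cons, ← ih]; ring

/-- Termwise form: subtracting the shifted Koszul sum lowers the number of variables by one — for `w ≥ 1`,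
`koszulHilbert (w+1) l m − [1 ≤ m]·koszulHilbert (w+1) l (m−1) = koszulHilbert w l m`. [folklore] -/
private theorem koszulHilbert_succ_sub_shift {w : ℕ} (hw : 1 ≤ w) (l : List ℕ) (m : ℕ) :
    koszulHilbert (w + 1) l m - (if 1 ≤ m then koszulHilbert (w + 1) l (m - 1) else 0) =
      koszulHilbert w l m := by
  have key : ∀ T : List ℕ,
      (-1 : ℤ) ^ T.length * chi (w + 1) ((m : ℤ) - (T.sum : ℕ)) -
          (-1 : ℤ) ^ T.length * chi (w + 1) ((m : ℤ) - 1 - (T.sum : ℕ)) =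
        (-1 : ℤ) ^ T.length * chi w ((m : ℤ) - (T.sum : ℕ)) := by
    intro T
    rw [← mul_sub, show (m : ℤ) - 1 - (T.sum : ℕ) = ((m : ℤ) - (T.sum : ℕ)) - 1 by ring,
      chi_succ_sub_chi_succ_pred hw]
  unfold koszulHilbert
  split_ifs with hm
  · rw [list_sum_map_sub_sum_map]
    congr 1
    refine List.map_congr_left fun T _ => ?_
    rw [show (((m - 1 : ℕ) : ℤ)) = (m : ℤ) - 1 by push_cast [Nat.cast_sub hm]; ring]
    exact key T
  · -- `m = 0`: the shifted terms `χ_{w+1}(−1 − ΣT)` all vanish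
    have hm0 : m = 0 := by omega
    subst hm0
    rw [sub_zero]
    congr 1
    refine List.map_congr_left fun T _ => ?_
    have hneg : ((0 : ℕ) : ℤ) - 1 - ((T.sum : ℕ) : ℤ) < 0 := by omega
    rw [← key T, chi_of_neg (w + 1) hneg, mul_zero, sub_zero]

/-- **A linear form in a regular sequence kills one variable**: `koszulHilbert (v+1) (l ++ [1]) m = koszulHilbert v l m`
(`v ≥ 1`). [cite: Kloosterman2023, §2 eq. (1)] -/
theorem koszulHilbert_succ_concat_one {v : ℕ} (hv : 1 ≤ v) (l : List ℕ) (m : ℕ) :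
    koszulHilbert (v + 1) (l ++ [1]) m = koszulHilbert v l m := by
  rw [koszulHilbert_concat, koszulHilbert_succ_sub_shift hv]

/-- Iterated: `j` linear forms kill `j` variables — `koszulHilbert (v+j) (l ++ 1^j) m = koszulHilbert v l m` (`v ≥ 1`).
[cite: Kloosterman2023, §2 eq. (1)] -/
theorem koszulHilbert_add_append_replicate_one {v : ℕ} (hv : 1 ≤ v) (l : List ℕ) (j m : ℕ) :
    koszulHilbert (v + j) (l ++ List.replicate j 1) m = koszulHilbert v l m := by
  induction j generalizing m with
  | zero => simp
  | succ j ih =>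
    rw [List.replicate_succ', ← List.append_assoc, ← add_assoc,
      koszulHilbert_succ_concat_one (by omega) _ m, ih]

/-- The Koszul sum of two quadrics: `koszulHilbert v [2,2] m = χ_v(m) − 2χ_v(m−2) + χ_v(m−4)`.
[cite: Kloosterman2023, §2 eq. (1)] -/
theorem koszulHilbert_two_two (v m : ℕ) :
    koszulHilbert v [2, 2] m = chi v m - 2 * chi v ((m : ℤ) - 2) + chi v ((m : ℤ) - 4) := by
  unfold koszulHilbert
  simp only [List.sublists_cons, List.sublists_nil, List.map_cons, List.map_nil, List.cons_append,
    List.nil_append, List.sum_cons, List.sum_nil, List.length_nil, List.length_cons, pow_zero, one_mul,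
    List.bind_eq_flatMap, List.flatMap_cons, List.flatMap_nil]
  push_cast
  ring

end Combinatorics

/-! ## §2 Hilbert functions of coordinate-subspace ideals and of their hypersurface sections -/

section HilbertFunctions

variable {K : Type u} [Field K] {n : ℕ}

local notation "𝓗(" I ", " m ")" =>
  (((finrank K (homogeneousSubmodule (Fin (n + 1)) K m) - finrank K (idealDegree I m) : ℕ) : ℤ))

/-- The ideal `(x_i : i ∈ s)` of a coordinate subspace is homogeneous. [folklore] -/
private theorem isHomogeneous_span_X_image (s : Set (Fin (n + 1))) :
    (Ideal.span (X '' s : Set (MvPolynomial (Fin (n + 1)) K))).IsHomogeneous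
      (homogeneousSubmodule (Fin (n + 1)) K) := by
  refine Ideal.homogeneous_span _ _ fun x hx => ?_
  obtain ⟨i, -, rfl⟩ := hx
  exact ⟨1, isHomogeneous_X K i⟩

/-- A variable outside `s` is a non-zero-divisor modulo the prime `(x_i : i ∈ s)`. [folklore] -/
private theorem mem_of_X_mul_mem_span_X_image {s : Set (Fin (n + 1))} {i : Fin (n + 1)} (hi : i ∉ s)
    (u : MvPolynomial (Fin (n + 1)) K) (h : X i * u ∈ Ideal.span (X '' s : Set (MvPolynomial (Fin (n + 1)) K))) :
    u ∈ Ideal.span (X '' s : Set (MvPolynomial (Fin (n + 1)) K)) := by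
  rcases (isPrime_span_X_image (R := K) s).mem_or_mem h with h | h
  · exact absurd (X_mem_span_X_image_iff.mp h) hi
  · exact h

/-- More generally, anything outside the prime `(x_i : i ∈ s)` is a non-zero-divisor modulo it. [folklore] -/
private theorem mem_of_mul_mem_span_X_image {s : Set (Fin (n + 1))} {Q : MvPolynomial (Fin (n + 1)) K}
    (hQ : Q ∉ Ideal.span (X '' s : Set (MvPolynomial (Fin (n + 1)) K)))
    (u : MvPolynomial (Fin (n + 1)) K) (h : Q * u ∈ Ideal.span (X '' s : Set (MvPolynomial (Fin (n + 1)) K))) :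
    u ∈ Ideal.span (X '' s : Set (MvPolynomial (Fin (n + 1)) K)) :=
  ((isPrime_span_X_image (R := K) s).mem_or_mem h).resolve_left hQ

/-- Reading a truncated shift `[q ≤ m]·χ_v(m − q)` as `χ_v(m − q)` with an integer argument. [folklore] -/
private theorem ite_chi_eq (q m : ℕ) (g : ℤ → ℤ) (hg : ∀ z, z < 0 → g z = 0) :
    (if q ≤ m then g (((m - q : ℕ) : ℤ)) else 0) = g ((m : ℤ) - q) := by
  split_ifs with h
  · rw [Nat.cast_sub h]
  · rw [hg _ (by omega)]

/-- **The hypersurface-section formula with integer shifts**: if `h_I = g` for a function `g : ℤ → ℤ` vanishing on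
the negatives, and `Q ≠ 0` is a form of degree `q` which is a non-zero-divisor modulo the homogeneous ideal `I`, then
`h_{I+(Q)}(m) = g(m) − g(m − q)`. [cite: Philippon1986, Lemme 3.1] -/
private theorem hilb_sup_span_eq {I : Ideal (MvPolynomial (Fin (n + 1)) K)}
    (hI : I.IsHomogeneous (homogeneousSubmodule (Fin (n + 1)) K)) {Q : MvPolynomial (Fin (n + 1)) K}
    (hQ0 : Q ≠ 0) {q : ℕ} (hQ : Q.IsHomogeneous q) (hnzd : ∀ f, Q * f ∈ I → f ∈ I)
    {g : ℤ → ℤ} (hg : ∀ z, z < 0 → g z = 0) (hIg : ∀ m : ℕ, 𝓗(I, m) = g m) (m : ℕ) :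
    𝓗(I ⊔ Ideal.span {Q}, m) = g m - g ((m : ℤ) - q) := by
  rw [hilbert_sup_span_eq_sub hI hQ0 hQ hnzd m, hIg, ← ite_chi_eq q m g hg]
  congr 1
  split_ifs with h
  · exact hIg _
  · rfl

/-- **The Hilbert function of a coordinate subspace**: for a set `C` of at most `n` of the `n+1` variables,
`h_{(x_i : i ∈ C)}(m) = χ_{n+1−|C|}(m) = binom(m + n − |C|, n − |C|)` — the coordinate ring of `V(x_C) ≅ ℙ^{n−|C|}`;
eq. (1) for the regular sequence of the `|C|` linear forms `x_i`, `i ∈ C` ("`χ(m) = dim S(X)_m`", here `X = ℙ^{n−|C|}`).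
[cite: Kloosterman2023, §2 eq. (1)] -/
theorem hilbert_span_X_image_eq_chi (C : Finset (Fin (n + 1))) (hC : C.card ≤ n) (m : ℕ) :
    𝓗(Ideal.span (X '' (C : Set (Fin (n + 1))) : Set (MvPolynomial (Fin (n + 1)) K)), m) =
      chi (n + 1 - C.card) m := by
  induction C using Finset.induction_on generalizing m with
  | empty =>
    rw [Finset.coe_empty, Set.image_empty, Ideal.span_empty, Finset.card_empty, Nat.sub_zero]
    exact hilbert_bot_eq_chi n m
  | @insert i C hi ih =>
    rw [Finset.card_insert_of_notMem hi] at hC ⊢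
    have hC' : C.card ≤ n := by omega
    rw [Finset.coe_insert, Set.image_insert_eq, Ideal.span_insert, sup_comm]
    have hiC : i ∉ (C : Set (Fin (n + 1))) := fun h => hi (Finset.mem_coe.mp h)
    rw [hilb_sup_span_eq (isHomogeneous_span_X_image _) (X_ne_zero i) (isHomogeneous_X K i)
      (mem_of_X_mul_mem_span_X_image hiC) (fun z hz => chi_of_neg _ hz) (fun m => ih hC' m) m]
    obtain ⟨w, hw⟩ : ∃ w, n + 1 - C.card = w + 1 := ⟨n - C.card, by omega⟩
    rw [hw, show n + 1 - (C.card + 1) = w by omega, Nat.cast_one]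
    exact chi_succ_sub_chi_succ_pred (by omega) _

/-- A homogeneous ideal generated by forms of positive degree does not contain `1` (constant terms vanish).
[folklore] -/
private theorem one_notMem_of_le_ker {I : Ideal (MvPolynomial (Fin (n + 1)) K)}
    (hI : I ≤ RingHom.ker (constantCoeff : MvPolynomial (Fin (n + 1)) K →+* K)) :
    (1 : MvPolynomial (Fin (n + 1)) K) ∉ I := by
  intro h1
  have := hI h1
  rw [RingHom.mem_ker, map_one] at this
  exact one_ne_zero this

/-- `(x_i : i ∈ s)` kills constant terms. [folklore] -/
private theorem span_X_image_le_ker (s : Set (Fin (n + 1))) :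
    Ideal.span (X '' s : Set (MvPolynomial (Fin (n + 1)) K)) ≤
      RingHom.ker (constantCoeff : MvPolynomial (Fin (n + 1)) K →+* K) := by
  refine Ideal.span_le.mpr ?_
  rintro _ ⟨i, -, rfl⟩
  simp [RingHom.mem_ker]

/-- A form of positive degree kills constant terms. [folklore] -/
private theorem span_singleton_le_ker {Q : MvPolynomial (Fin (n + 1)) K} {q : ℕ} (hQ : Q.IsHomogeneous q)
    (hq : 0 < q) :
    Ideal.span {Q} ≤ RingHom.ker (constantCoeff : MvPolynomial (Fin (n + 1)) K →+* K) := by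
  refine (Ideal.span_singleton_le_iff_mem _).mpr ?_
  rw [RingHom.mem_ker, constantCoeff_eq]
  exact hQ.coeff_eq_zero (by rw [map_zero]; exact hq.ne)

/-- A non-zero-divisor modulo an ideal not containing `1` is non-zero. [folklore] -/
private theorem ne_zero_of_nzd {I : Ideal (MvPolynomial (Fin (n + 1)) K)} (h1 : (1 : MvPolynomial (Fin (n + 1)) K) ∉ I)
    {Q : MvPolynomial (Fin (n + 1)) K} (hnzd : ∀ f, Q * f ∈ I → f ∈ I) : Q ≠ 0 := by
  rintro rfl
  exact h1 (hnzd 1 (by rw [zero_mul]; exact Submodule.zero_mem _))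

/-- **Lattice identity with integer values**: `h_{I ∩ J}(m) = h_I(m) + h_J(m) − h_{I+J}(m)`. [folklore] -/
private theorem hilb_inf_eq {I J : Ideal (MvPolynomial (Fin (n + 1)) K)}
    (hI : I.IsHomogeneous (homogeneousSubmodule (Fin (n + 1)) K))
    (hJ : J.IsHomogeneous (homogeneousSubmodule (Fin (n + 1)) K)) (m : ℕ) :
    𝓗(I ⊓ J, m) = 𝓗(I, m) + 𝓗(J, m) - 𝓗(I ⊔ J, m) := by
  have h := hilbert_inf_add_hilbert_sup hI hJ m
  omega

end HilbertFunctions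

/-! ## §3 Proposition 6.1: the fibres of the quartic degeneration -/

section Prop61

variable {K : Type u} [Field K] {n : ℕ}

local notation "𝓗(" I ", " m ")" =>
  (((finrank K (homogeneousSubmodule (Fin (n + 1)) K m) - finrank K (idealDegree I m) : ℕ) : ℤ))

variable (T : Finset (Fin (n + 1))) (i₀ i₁ i₂ i₃ : Fin (n + 1)) (Q₀₃ Q₁₃ : MvPolynomial (Fin (n + 1)) K)

/-- The ideal `I^{(t)} = ⟨x₀x₂ + tQ₁₃, x₁x₂ − tQ₀₃⟩ + ⟨x_i : i ∈ T⟩` of the general fibre `Y_t` (the tree's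
`ciQuadricsIdeal` plus its linear part; printed with `T = {k+3, …, 2k+1}`). [cite: Kloosterman2025, Prop. 6.1 (proof)] -/
def quarticFibreIdeal (t : K) : Ideal (MvPolynomial (Fin (n + 1)) K) :=
  ciQuadricsIdeal (X i₀) (X i₁) (X i₂) Q₀₃ Q₁₃ (C t) ⊔ Ideal.span (X '' (T : Set (Fin (n + 1))))

/-- The limit ideal `I^{(0)} = ⟨x₀x₂, x₁x₂, x₁Q₁₃ + x₀Q₀₃⟩ + ⟨x_i : i ∈ T⟩`. [cite: Kloosterman2025, Prop. 6.1 (proof)] -/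
def quarticLimitIdeal : Ideal (MvPolynomial (Fin (n + 1)) K) :=
  Ideal.span {X i₀ * X i₂, X i₁ * X i₂, X i₁ * Q₁₃ + X i₀ * Q₀₃} ⊔ Ideal.span (X '' (T : Set (Fin (n + 1))))

variable {T i₀ i₁ i₂ i₃ Q₀₃ Q₁₃}

/-- **`V(I^{(0)}) = V(x₂, x₁Q₁₃ + x₀Q₀₃, x_T) ∪ V(x₀, x₁, x_T)` scheme-theoretically**: the limit ideal IS the
intersection `I^{(0)} = ⟨x₀, x₁, x_T⟩ ∩ (⟨x₂, x_T⟩ + ⟨x₁Q₁₃ + x₀Q₀₃⟩)` of the ideal of the plane `Π₁` and the ideal of the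
residual cubic complete intersection (for every `Q₀₃, Q₁₃`). [cite: Kloosterman2025, Prop. 6.1 (proof, last display)] -/
theorem quarticLimitIdeal_eq_inf (h₀₂ : i₀ ≠ i₂) (h₁₂ : i₁ ≠ i₂) :
    quarticLimitIdeal T i₀ i₁ i₂ Q₀₃ Q₁₃ =
      Ideal.span (X '' (({i₀, i₁} : Set (Fin (n + 1))) ∪ ↑T)) ⊓
        (Ideal.span (X '' (({i₂} : Set (Fin (n + 1))) ∪ ↑T)) ⊔ Ideal.span {X i₁ * Q₁₃ + X i₀ * Q₀₃}) := by
  set A : Ideal (MvPolynomial (Fin (n + 1)) K) := Ideal.span (X '' (({i₀, i₁} : Set (Fin (n + 1))) ∪ ↑T)) with hA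
  set B₀ : Ideal (MvPolynomial (Fin (n + 1)) K) := Ideal.span (X '' (({i₂} : Set (Fin (n + 1))) ∪ ↑T)) with hB₀
  set L : MvPolynomial (Fin (n + 1)) K := X i₁ * Q₁₃ + X i₀ * Q₀₃ with hL
  have hX : ∀ {s : Set (Fin (n + 1))} {i : Fin (n + 1)}, i ∈ s →
      (X i : MvPolynomial (Fin (n + 1)) K) ∈ Ideal.span (X '' s) :=
    fun hi => Ideal.subset_span ⟨_, hi, rfl⟩
  have hx₀A : (X i₀ : MvPolynomial (Fin (n + 1)) K) ∈ A := hX (Or.inl (Or.inl rfl))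
  have hx₁A : (X i₁ : MvPolynomial (Fin (n + 1)) K) ∈ A := hX (Or.inl (Or.inr rfl))
  have hx₂B : (X i₂ : MvPolynomial (Fin (n + 1)) K) ∈ B₀ := hX (Or.inl rfl)
  have hLA : L ∈ A := Ideal.add_mem _ (Ideal.mul_mem_right _ _ hx₁A) (Ideal.mul_mem_right _ _ hx₀A)
  have hTA : Ideal.span (X '' (T : Set (Fin (n + 1)))) ≤ A := Ideal.span_mono (Set.image_mono Set.subset_union_right)
  have hTB : Ideal.span (X '' (T : Set (Fin (n + 1)))) ≤ B₀ := Ideal.span_mono (Set.image_mono Set.subset_union_right)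
  refine le_antisymm ?_ ?_
  · refine sup_le (Ideal.span_le.mpr ?_) (le_inf hTA (hTB.trans le_sup_left))
    rintro y hy
    simp only [Set.mem_insert_iff, Set.mem_singleton_iff] at hy
    rcases hy with rfl | rfl | rfl
    · exact ⟨Ideal.mul_mem_right _ _ hx₀A, Ideal.mem_sup_left (Ideal.mul_mem_left _ _ hx₂B)⟩
    · exact ⟨Ideal.mul_mem_right _ _ hx₁A, Ideal.mem_sup_left (Ideal.mul_mem_left _ _ hx₂B)⟩
    · exact ⟨hLA, Ideal.mem_sup_right (Ideal.subset_span rfl)⟩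
  · rintro f ⟨hfA, hfB⟩
    obtain ⟨b, hb, s, hs, rfl⟩ := Submodule.mem_sup.mp hfB
    have hsA : s ∈ A := (Ideal.span_singleton_le_iff_mem _ |>.mpr hLA) hs
    have hbA : b ∈ A := by
      have := Ideal.sub_mem _ hfA hsA
      rwa [add_sub_cancel_right] at this
    -- `b ∈ ⟨x₀,x₁,x_T⟩ ∩ ⟨x₂,x_T⟩ = ⟨x_T⟩ + ⟨x₀x₂, x₁x₂⟩`
    have hdisj : Disjoint ({i₀, i₁} : Set (Fin (n + 1))) {i₂} := by
      rw [Set.disjoint_singleton_right]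
      rintro (h | h)
      · exact h₀₂ h.symm
      · exact h₁₂ h.symm
    have hb' := (span_X_inf_span_X_eq (K := K) (T : Set (Fin (n + 1))) hdisj).le ⟨hbA, hb⟩
    refine Ideal.add_mem _ ?_ (Ideal.mem_sup_left ((Ideal.span_singleton_le_iff_mem _).mpr
      (Ideal.subset_span (by rw [hL]; simp)) hs))
    refine (sup_le le_sup_right ((Ideal.span_le.mpr ?_)) : _ ≤ quarticLimitIdeal T i₀ i₁ i₂ Q₀₃ Q₁₃) hb'
    rintro _ ⟨⟨a, b⟩, ⟨ha, hb⟩, rfl⟩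
    simp only [Set.mem_insert_iff, Set.mem_singleton_iff] at ha hb
    subst hb
    refine Ideal.mem_sup_left (Ideal.subset_span ?_)
    rcases ha with rfl | rfl
    · simp
    · simp

/-- The form `L = x₁Q₁₃ + x₀Q₀₃` cutting the residual component is a cubic. [folklore] -/
private theorem isHomogeneous_L (hQ₀₃ : Q₀₃.IsHomogeneous 2) (hQ₁₃ : Q₁₃.IsHomogeneous 2) :
    (X i₁ * Q₁₃ + X i₀ * Q₀₃).IsHomogeneous 3 :=
  ((isHomogeneous_X K i₁).mul hQ₁₃).add ((isHomogeneous_X K i₀).mul hQ₀₃)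

/-- Set bookkeeping: `{a} ∪ T` as a `Finset.insert`. [folklore] -/
private theorem coe_insert_eq (a : Fin (n + 1)) :
    ((insert a T : Finset (Fin (n + 1))) : Set (Fin (n + 1))) = ({a} : Set (Fin (n + 1))) ∪ ↑T := by
  rw [Finset.coe_insert, Set.singleton_union]

/-- `{a, b} ∪ T` as a double `Finset.insert`. [folklore] -/
private theorem coe_insert_insert_eq (a b : Fin (n + 1)) :
    ((insert a (insert b T) : Finset (Fin (n + 1))) : Set (Fin (n + 1))) = ({a, b} : Set (Fin (n + 1))) ∪ ↑T := by
  rw [Finset.coe_insert, Finset.coe_insert, Set.insert_union, Set.singleton_union]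

/-- `{a, b, c} ∪ T` as a triple `Finset.insert`. [folklore] -/
private theorem coe_insert_insert_insert_eq (a b c : Fin (n + 1)) :
    ((insert a (insert b (insert c T)) : Finset (Fin (n + 1))) : Set (Fin (n + 1))) =
      ({a, b, c} : Set (Fin (n + 1))) ∪ ↑T := by
  rw [Finset.coe_insert, Finset.coe_insert, Finset.coe_insert, Set.insert_union, Set.insert_union,
    Set.singleton_union]

/-- **The Hilbert function of the limit** `I^{(0)} = ⟨x₀,x₁,x_T⟩ ∩ ⟨x₂, L, x_T⟩`, `L = x₁Q₁₃ + x₀Q₀₃`: with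
`v = n + 1 − |T|` the number of variables of `ℙ^n` off `T`,
`h_{I^{(0)}}(m) = χ_{v−2}(m) + (χ_{v−1}(m) − χ_{v−1}(m−3)) − χ_{v−3}(m)` (plane + cubic complete intersection − their common
hyperplane `V(x₀,x₁,x₂,x_T)`), as soon as the residual piece IS a complete intersection, i.e. `L ∉ ⟨x₂, x_T⟩`.
[cite: Kloosterman2025, Prop. 6.1 (proof: "one easily checks that the Hilbert functions of I^(0) and I^(t) coincide")] -/
theorem hilbert_quarticLimitIdeal (h₀₁ : i₀ ≠ i₁) (h₀₂ : i₀ ≠ i₂) (h₁₂ : i₁ ≠ i₂) (hi₀ : i₀ ∉ T) (hi₁ : i₁ ∉ T)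
    (hi₂ : i₂ ∉ T) (hQ₀₃ : Q₀₃.IsHomogeneous 2) (hQ₁₃ : Q₁₃.IsHomogeneous 2)
    (hL : X i₁ * Q₁₃ + X i₀ * Q₀₃ ∉ Ideal.span (X '' (({i₂} : Set (Fin (n + 1))) ∪ ↑T)))
    (hT : T.card + 3 ≤ n) (m : ℕ) :
    𝓗(quarticLimitIdeal T i₀ i₁ i₂ Q₀₃ Q₁₃, m) =
      chi (n - 1 - T.card) m + (chi (n - T.card) m - chi (n - T.card) ((m : ℤ) - 3)) - chi (n - 2 - T.card) m := by
  set A : Ideal (MvPolynomial (Fin (n + 1)) K) := Ideal.span (X '' (({i₀, i₁} : Set (Fin (n + 1))) ∪ ↑T)) with hA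
  set B₀ : Ideal (MvPolynomial (Fin (n + 1)) K) := Ideal.span (X '' (({i₂} : Set (Fin (n + 1))) ∪ ↑T)) with hB₀
  set L : MvPolynomial (Fin (n + 1)) K := X i₁ * Q₁₃ + X i₀ * Q₀₃ with hL'
  have hAh : A.IsHomogeneous (homogeneousSubmodule (Fin (n + 1)) K) := isHomogeneous_span_X_image _
  have hB₀h : B₀.IsHomogeneous (homogeneousSubmodule (Fin (n + 1)) K) := isHomogeneous_span_X_image _
  have hLh : L.IsHomogeneous 3 := isHomogeneous_L hQ₀₃ hQ₁₃
  have hBh : (B₀ ⊔ Ideal.span {L}).IsHomogeneous (homogeneousSubmodule (Fin (n + 1)) K) :=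
    hB₀h.sup (Ideal.homogeneous_span _ _ fun x hx => by
      rw [Set.mem_singleton_iff] at hx
      exact hx ▸ ⟨3, hLh⟩)
  -- the three coordinate-subspace Hilbert functions
  have hcardA : (insert i₀ (insert i₁ T)).card = T.card + 2 := by
    rw [Finset.card_insert_of_notMem (by simp [h₀₁, hi₀]), Finset.card_insert_of_notMem hi₁]
  have hcardB : (insert i₂ T).card = T.card + 1 := by rw [Finset.card_insert_of_notMem hi₂]
  have hcardAB : (insert i₀ (insert i₁ (insert i₂ T))).card = T.card + 3 := by
    rw [Finset.card_insert_of_notMem (by simp [h₀₁, h₀₂, hi₀]), Finset.card_insert_of_notMem (by simp [h₁₂, hi₁]),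
      Finset.card_insert_of_notMem hi₂]
  have hHA : ∀ m : ℕ, 𝓗(A, m) = chi (n - 1 - T.card) m := by
    intro m
    have h := hilbert_span_X_image_eq_chi (K := K) (insert i₀ (insert i₁ T)) (by omega) m
    rw [coe_insert_insert_eq, hcardA] at h
    rw [hA, h]
    congr 1
    omega
  have hHB₀ : ∀ m : ℕ, 𝓗(B₀, m) = chi (n - T.card) m := by
    intro m
    have h := hilbert_span_X_image_eq_chi (K := K) (insert i₂ T) (by omega) m
    rw [coe_insert_eq, hcardB] at h
    rw [hB₀, h]
    congr 1
    omega
  have hHB : ∀ m : ℕ, 𝓗(B₀ ⊔ Ideal.span {L}, m) = chi (n - T.card) m - chi (n - T.card) ((m : ℤ) - 3) := by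
    intro m
    have hL0 : L ≠ 0 := fun h => hL (by rw [h]; exact Submodule.zero_mem _)
    have h := hilb_sup_span_eq hB₀h hL0 hLh (mem_of_mul_mem_span_X_image hL) (fun z hz => chi_of_neg _ hz) hHB₀ m
    rw [h, Nat.cast_ofNat]
  have hsup : A ⊔ (B₀ ⊔ Ideal.span {L}) =
      Ideal.span (X '' ((insert i₀ (insert i₁ (insert i₂ T)) : Finset (Fin (n + 1))) : Set (Fin (n + 1)))) := by
    have hLA : L ∈ A :=
      Ideal.add_mem _ (Ideal.mul_mem_right _ _ (Ideal.subset_span ⟨_, Or.inl (Or.inr rfl), rfl⟩))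
        (Ideal.mul_mem_right _ _ (Ideal.subset_span ⟨_, Or.inl (Or.inl rfl), rfl⟩))
    rw [← sup_assoc, sup_eq_left.mpr (((Ideal.span_singleton_le_iff_mem _).mpr hLA).trans le_sup_left), hA, hB₀,
      ← Ideal.span_union, ← Set.image_union, coe_insert_insert_insert_eq]
    congr 2
    ext j
    simp only [Set.mem_union, Set.mem_insert_iff, Set.mem_singleton_iff, Finset.mem_coe]
    tauto
  have hHAB : ∀ m : ℕ, 𝓗(A ⊔ (B₀ ⊔ Ideal.span {L}), m) = chi (n - 2 - T.card) m := by
    intro m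
    rw [hsup, hilbert_span_X_image_eq_chi (K := K) _ (by omega) m, hcardAB]
    congr 1
    omega
  rw [quarticLimitIdeal_eq_inf h₀₂ h₁₂, hilb_inf_eq hAh hBh m, hHA, hHB, hHAB]

/-- The two quadrics `q₁ = x₀x₂ + tQ₁₃`, `q₂ = x₁x₂ − tQ₀₃` of `I^{(t)}` are forms of degree `2`. [folklore] -/
private theorem isHomogeneous_q₁ (hQ₁₃ : Q₁₃.IsHomogeneous 2) (t : K) :
    (X i₀ * X i₂ + C t * Q₁₃ : MvPolynomial (Fin (n + 1)) K).IsHomogeneous 2 :=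
  ((isHomogeneous_X K i₀).mul (isHomogeneous_X K i₂)).add (hQ₁₃.C_mul t)

/-- `q₂ = x₁x₂ − tQ₀₃` is a quadric. [folklore] -/
private theorem isHomogeneous_q₂ (hQ₀₃ : Q₀₃.IsHomogeneous 2) (t : K) :
    (X i₁ * X i₂ - C t * Q₀₃ : MvPolynomial (Fin (n + 1)) K).IsHomogeneous 2 :=
  ((isHomogeneous_X K i₁).mul (isHomogeneous_X K i₂)).sub (hQ₀₃.C_mul t)

/-- **The Hilbert function of the general fibre**: if `I^{(t)} = ⟨q₁, q₂, x_T⟩` is a complete intersection of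
multidegree `(2, 2, 1, …, 1)` — `q₁ = x₀x₂ + tQ₁₃ ∉ ⟨x_T⟩` and `q₂ = x₁x₂ − tQ₀₃` a non-zero-divisor modulo `⟨x_T, q₁⟩`
("`Y_t` is a complete intersection of multidegree `(2,2,1,…,1)`") — then
`h_{I^{(t)}}(m) = χ_v(m) − 2χ_v(m−2) + χ_v(m−4)`, `v = n + 1 − |T|`. [cite: Kloosterman2025, Prop. 6.1 (proof)]
[cite: Kloosterman2023, §2 eq. (1)] -/
theorem hilbert_quarticFibreIdeal {t : K} (hQ₀₃ : Q₀₃.IsHomogeneous 2) (hQ₁₃ : Q₁₃.IsHomogeneous 2)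
    (hq₁ : X i₀ * X i₂ + C t * Q₁₃ ∉ Ideal.span (X '' (T : Set (Fin (n + 1)))))
    (hq₂ : ∀ u, (X i₁ * X i₂ - C t * Q₀₃) * u ∈
        Ideal.span (X '' (T : Set (Fin (n + 1)))) ⊔ Ideal.span {X i₀ * X i₂ + C t * Q₁₃} →
      u ∈ Ideal.span (X '' (T : Set (Fin (n + 1)))) ⊔ Ideal.span {X i₀ * X i₂ + C t * Q₁₃})
    (hT : T.card ≤ n) (m : ℕ) :
    𝓗(quarticFibreIdeal T i₀ i₁ i₂ Q₀₃ Q₁₃ t, m) =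
      chi (n + 1 - T.card) m - 2 * chi (n + 1 - T.card) ((m : ℤ) - 2) + chi (n + 1 - T.card) ((m : ℤ) - 4) := by
  set J : Ideal (MvPolynomial (Fin (n + 1)) K) := Ideal.span (X '' (T : Set (Fin (n + 1)))) with hJ
  set q₁ : MvPolynomial (Fin (n + 1)) K := X i₀ * X i₂ + C t * Q₁₃ with hq₁'
  set q₂ : MvPolynomial (Fin (n + 1)) K := X i₁ * X i₂ - C t * Q₀₃ with hq₂'
  have hfib : quarticFibreIdeal T i₀ i₁ i₂ Q₀₃ Q₁₃ t = (J ⊔ Ideal.span {q₁}) ⊔ Ideal.span {q₂} := by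
    rw [quarticFibreIdeal, ciQuadricsIdeal, Ideal.span_insert, sup_comm (Ideal.span {q₁} ⊔ Ideal.span {q₂}) J,
      ← sup_assoc]
  have hJh : J.IsHomogeneous (homogeneousSubmodule (Fin (n + 1)) K) := isHomogeneous_span_X_image _
  have hq₁h : q₁.IsHomogeneous 2 := isHomogeneous_q₁ hQ₁₃ t
  have hq₂h : q₂.IsHomogeneous 2 := isHomogeneous_q₂ hQ₀₃ t
  have hJ₁h : (J ⊔ Ideal.span {q₁}).IsHomogeneous (homogeneousSubmodule (Fin (n + 1)) K) :=
    hJh.sup (Ideal.homogeneous_span _ _ fun x hx => by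
      rw [Set.mem_singleton_iff] at hx
      exact hx ▸ ⟨2, hq₁h⟩)
  have hHJ : ∀ m : ℕ, 𝓗(J, m) = chi (n + 1 - T.card) m := fun m => hilbert_span_X_image_eq_chi T hT m
  have hq₁0 : q₁ ≠ 0 := fun h => hq₁ (by rw [h]; exact Submodule.zero_mem _)
  have hHJ₁ : ∀ m : ℕ, 𝓗(J ⊔ Ideal.span {q₁}, m) =
      chi (n + 1 - T.card) m - chi (n + 1 - T.card) ((m : ℤ) - 2) := by
    intro m
    rw [hilb_sup_span_eq hJh hq₁0 hq₁h (mem_of_mul_mem_span_X_image hq₁) (fun z hz => chi_of_neg _ hz) hHJ m,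
      Nat.cast_ofNat]
  have h1 : (1 : MvPolynomial (Fin (n + 1)) K) ∉ J ⊔ Ideal.span {q₁} :=
    one_notMem_of_le_ker (sup_le (span_X_image_le_ker _) (span_singleton_le_ker hq₁h two_pos))
  have hq₂0 : q₂ ≠ 0 := ne_zero_of_nzd h1 hq₂
  rw [hfib, hilb_sup_span_eq hJ₁h hq₂0 hq₂h hq₂ (g := fun z => chi (n + 1 - T.card) z - chi (n + 1 - T.card) (z - 2))
    (fun z hz => by rw [chi_of_neg _ hz, chi_of_neg _ (by omega), sub_zero]) hHJ₁ m]
  ring_nf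

end Prop61

/-! ## §4 Proposition 6.1: "the Hilbert functions of `I^{(0)}` and `I^{(t)}` coincide" -/

section Prop61Flatness

variable {K : Type u} [Field K] {n : ℕ}

local notation "𝓗(" I ", " m ")" =>
  (((finrank K (homogeneousSubmodule (Fin (n + 1)) K m) - finrank K (idealDegree I m) : ℕ) : ℤ))

/-- The binomial identity behind Prop. 6.1's flatness: `(1 − s²)² = (1 − s)² + (1 − s)(1 − s³) − (1 − s)³` over
`(1 − s)^{w+3}`, read through Pascal's rule `χ_a = χ_{a+1} − χ_{a+1}(· − 1)`. [folklore] -/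
private theorem chi_quartic_flatness_identity {w : ℕ} (hw : 1 ≤ w) (z : ℤ) :
    chi (w + 3) z - 2 * chi (w + 3) (z - 2) + chi (w + 3) (z - 4) =
      chi (w + 1) z + (chi (w + 2) z - chi (w + 2) (z - 3)) - chi w z := by
  have h0 : ∀ y, chi w y = chi (w + 1) y - chi (w + 1) (y - 1) :=
    fun y => (chi_succ_sub_chi_succ_pred hw y).symm
  have h1 : ∀ y, chi (w + 1) y = chi (w + 2) y - chi (w + 2) (y - 1) :=
    fun y => (chi_succ_sub_chi_succ_pred (v := w + 1) (by omega) y).symm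
  have h2 : ∀ y, chi (w + 2) y = chi (w + 3) y - chi (w + 3) (y - 1) :=
    fun y => (chi_succ_sub_chi_succ_pred (v := w + 2) (by omega) y).symm
  rw [h0]
  simp only [h1]
  simp only [h2]
  ring_nf

variable {T : Finset (Fin (n + 1))} {i₀ i₁ i₂ i₃ : Fin (n + 1)} {Q₀₃ Q₁₃ : MvPolynomial (Fin (n + 1)) K}

/-- **Prop. 6.1, flatness: "one easily checks that the Hilbert functions of `I^{(0)}` and `I^{(t)}` coincide."**
For every `t` for which `I^{(t)} = ⟨x₀x₂ + tQ₁₃, x₁x₂ − tQ₀₃, x_T⟩` is a complete intersection of multidegree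
`(2,2,1,…,1)` and the residual piece `⟨x₂, x₁Q₁₃ + x₀Q₀₃, x_T⟩` of the limit is one of multidegree `(1,3,1,…,1)`,
`h_{I^{(t)}}(m) = h_{I^{(0)}}(m)` for all `m` — in `ℙ^n` with any tail `T` of at most `n − 3` further coordinates
(printed: `n = 2k+1`, `T = {k+3, …, 2k+1}`). Hence (each generator of `I^{(0)}` being a specialisation of an element of
`I^{(t)}`: tree `limitGenerator_mem_ciIdeal`) `(Y_t)` is a flat family. [cite: Kloosterman2025, Prop. 6.1 (proof)] -/
theorem hilbert_quarticFibreIdeal_eq_hilbert_quarticLimitIdeal {t : K} (h₀₁ : i₀ ≠ i₁) (h₀₂ : i₀ ≠ i₂)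
    (h₁₂ : i₁ ≠ i₂) (hi₀ : i₀ ∉ T) (hi₁ : i₁ ∉ T) (hi₂ : i₂ ∉ T) (hQ₀₃ : Q₀₃.IsHomogeneous 2)
    (hQ₁₃ : Q₁₃.IsHomogeneous 2)
    (hq₁ : X i₀ * X i₂ + C t * Q₁₃ ∉ Ideal.span (X '' (T : Set (Fin (n + 1)))))
    (hq₂ : ∀ u, (X i₁ * X i₂ - C t * Q₀₃) * u ∈
        Ideal.span (X '' (T : Set (Fin (n + 1)))) ⊔ Ideal.span {X i₀ * X i₂ + C t * Q₁₃} →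
      u ∈ Ideal.span (X '' (T : Set (Fin (n + 1)))) ⊔ Ideal.span {X i₀ * X i₂ + C t * Q₁₃})
    (hL : X i₁ * Q₁₃ + X i₀ * Q₀₃ ∉ Ideal.span (X '' (({i₂} : Set (Fin (n + 1))) ∪ ↑T)))
    (hT : T.card + 3 ≤ n) (m : ℕ) :
    𝓗(quarticFibreIdeal T i₀ i₁ i₂ Q₀₃ Q₁₃ t, m) = 𝓗(quarticLimitIdeal T i₀ i₁ i₂ Q₀₃ Q₁₃, m) := by
  rw [hilbert_quarticFibreIdeal hQ₀₃ hQ₁₃ hq₁ hq₂ (by omega) m,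
    hilbert_quarticLimitIdeal h₀₁ h₀₂ h₁₂ hi₀ hi₁ hi₂ hQ₀₃ hQ₁₃ hL hT m]
  obtain ⟨w, hw⟩ : ∃ w, n - 2 - T.card = w := ⟨_, rfl⟩
  rw [hw, show n + 1 - T.card = w + 3 by omega, show n - T.card = w + 2 by omega,
    show n - 1 - T.card = w + 1 by omega]
  exact chi_quartic_flatness_identity (by omega) m

/-! ### The residual component of the central fibre: `X ∩ V(x₂, x_T) = Π₂ ∪ V(x₂, L, x_T)` -/

/-- On the hyperplane `x₂ = 0` a quartic in the normal form `f₀ = x₀x₂Q₀₂ + x₁x₂Q₁₂ + x₀x₃Q₀₃ + x₁x₃Q₁₃ + Σ_{i∈T} xᵢPᵢ`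
restricts to `x₃ · L`, `L = x₁Q₁₃ + x₀Q₀₃`: `⟨f₀, x₂, x_T⟩ = ⟨x₃L, x₂, x_T⟩` (the linear part `h = Σ xᵢPᵢ` is any element
of `⟨x_T⟩`). [cite: Kloosterman2025, Prop. 6.1 (proof, last display)] -/
theorem span_quartic_X_sup_eq (Q₀₂ Q₁₂ : MvPolynomial (Fin (n + 1)) K) {h : MvPolynomial (Fin (n + 1)) K}
    (hh : h ∈ Ideal.span (X '' (T : Set (Fin (n + 1))))) :
    Ideal.span {quarticNormalForm (X i₀) (X i₁) (X i₂) (X i₃) Q₀₂ Q₁₂ Q₀₃ Q₁₃ + h, X i₂} ⊔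
        Ideal.span (X '' (T : Set (Fin (n + 1)))) =
      Ideal.span {X i₃ * (X i₁ * Q₁₃ + X i₀ * Q₀₃), X i₂} ⊔ Ideal.span (X '' (T : Set (Fin (n + 1)))) := by
  have key : quarticNormalForm (X i₀) (X i₁) (X i₂) (X i₃) Q₀₂ Q₁₂ Q₀₃ Q₁₃ =
      X i₃ * (X i₁ * Q₁₃ + X i₀ * Q₀₃) + X i₂ * (X i₀ * Q₀₂ + X i₁ * Q₁₂) := by
    rw [quarticNormalForm_def]; ring
  have hx₂l : (X i₂ : MvPolynomial (Fin (n + 1)) K) ∈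
      Ideal.span {quarticNormalForm (X i₀) (X i₁) (X i₂) (X i₃) Q₀₂ Q₁₂ Q₀₃ Q₁₃ + h, X i₂} :=
    Ideal.subset_span (by simp)
  have hx₂r : (X i₂ : MvPolynomial (Fin (n + 1)) K) ∈ Ideal.span {X i₃ * (X i₁ * Q₁₃ + X i₀ * Q₀₃), X i₂} :=
    Ideal.subset_span (by simp)
  refine le_antisymm (sup_le (Ideal.span_le.mpr ?_) le_sup_right) (sup_le (Ideal.span_le.mpr ?_) le_sup_right)
  · rintro y hy
    simp only [Set.mem_insert_iff, Set.mem_singleton_iff] at hy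
    rcases hy with rfl | rfl
    · rw [key]
      exact Ideal.add_mem _ (Ideal.mem_sup_left (Ideal.add_mem _ (Ideal.subset_span (by simp))
        (Ideal.mul_mem_right _ _ hx₂r))) (Ideal.mem_sup_right hh)
    · exact Ideal.mem_sup_left hx₂r
  · rintro y hy
    simp only [Set.mem_insert_iff, Set.mem_singleton_iff] at hy
    rcases hy with rfl | rfl
    · have e : X i₃ * (X i₁ * Q₁₃ + X i₀ * Q₀₃) =
          (quarticNormalForm (X i₀) (X i₁) (X i₂) (X i₃) Q₀₂ Q₁₂ Q₀₃ Q₁₃ + h) -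
            X i₂ * (X i₀ * Q₀₂ + X i₁ * Q₁₂) - h := by
        rw [key]; ring
      rw [e]
      exact Ideal.sub_mem _ (Ideal.sub_mem _ (Ideal.mem_sup_left (Ideal.subset_span (by simp)))
        (Ideal.mem_sup_left (Ideal.mul_mem_right _ _ hx₂l))) (Ideal.mem_sup_right hh)
    · exact Ideal.mem_sup_left hx₂l

/-- … and `⟨x₃L, x₂, x_T⟩ = ⟨x₂, x₃, x_T⟩ ∩ ⟨x₂, L, x_T⟩` — the hyperplane section `X ∩ V(x₂, x_T)` is, as a scheme, the
union of the plane `Π₂ = V(x₂, x₃, x_T)` and the residual cubic `V(x₂, L, x_T)` (whose class is therefore `h·[V(x₂,x_T)] − [Π₂]`,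
"`Y_0` is the union of `Π₁` and a `k`-dimensional subscheme whose class is `h^k − [Π₂]`"), as soon as `L ∉ ⟨x₂, x₃, x_T⟩`.
[cite: Kloosterman2025, Prop. 6.1 (proof, last paragraph)] -/
theorem span_X_mul_L_sup_eq_inf
    (hL : X i₁ * Q₁₃ + X i₀ * Q₀₃ ∉ Ideal.span (X '' (({i₂, i₃} : Set (Fin (n + 1))) ∪ ↑T))) :
    Ideal.span {X i₃ * (X i₁ * Q₁₃ + X i₀ * Q₀₃), X i₂} ⊔ Ideal.span (X '' (T : Set (Fin (n + 1)))) =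
      Ideal.span (X '' (({i₂, i₃} : Set (Fin (n + 1))) ∪ ↑T)) ⊓
        (Ideal.span (X '' (({i₂} : Set (Fin (n + 1))) ∪ ↑T)) ⊔ Ideal.span {X i₁ * Q₁₃ + X i₀ * Q₀₃}) := by
  set P : Ideal (MvPolynomial (Fin (n + 1)) K) := Ideal.span (X '' (({i₂, i₃} : Set (Fin (n + 1))) ∪ ↑T)) with hP
  set B₀ : Ideal (MvPolynomial (Fin (n + 1)) K) := Ideal.span (X '' (({i₂} : Set (Fin (n + 1))) ∪ ↑T)) with hB₀
  set L : MvPolynomial (Fin (n + 1)) K := X i₁ * Q₁₃ + X i₀ * Q₀₃ with hL'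
  have hX : ∀ {s : Set (Fin (n + 1))} {i : Fin (n + 1)}, i ∈ s →
      (X i : MvPolynomial (Fin (n + 1)) K) ∈ Ideal.span (X '' s) :=
    fun hi => Ideal.subset_span ⟨_, hi, rfl⟩
  have hB₀P : B₀ ≤ P := Ideal.span_mono (Set.image_mono (Set.union_subset_union_left _ (by simp)))
  have hTB₀ : Ideal.span (X '' (T : Set (Fin (n + 1)))) ≤ B₀ := Ideal.span_mono (Set.image_mono Set.subset_union_right)
  have hB₀l : B₀ ≤ Ideal.span {X i₃ * L, X i₂} ⊔ Ideal.span (X '' (T : Set (Fin (n + 1)))) := by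
    refine Ideal.span_le.mpr ?_
    rintro _ ⟨j, hj, rfl⟩
    rcases hj with hj | hj
    · rw [Set.mem_singleton_iff] at hj
      subst hj
      exact Ideal.mem_sup_left (Ideal.subset_span (by simp))
    · exact Ideal.mem_sup_right (hX hj)
  refine le_antisymm ?_ ?_
  · refine sup_le (Ideal.span_le.mpr ?_) (le_inf (hTB₀.trans hB₀P) (hTB₀.trans le_sup_left))
    rintro y hy
    simp only [Set.mem_insert_iff, Set.mem_singleton_iff] at hy
    rcases hy with rfl | rfl
    · exact ⟨Ideal.mul_mem_right _ _ (hX (Or.inl (Or.inr rfl))),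
        Ideal.mem_sup_right (Ideal.mul_mem_left _ _ (Ideal.subset_span rfl))⟩
    · exact ⟨hX (Or.inl (Or.inl rfl)), Ideal.mem_sup_left (hX (Or.inl rfl))⟩
  · rintro f ⟨hfP, hfB⟩
    obtain ⟨b, hb, s, hs, rfl⟩ := Submodule.mem_sup.mp hfB
    obtain ⟨a, rfl⟩ := Ideal.mem_span_singleton'.mp hs
    -- `a·L ∈ P`, `L ∉ P` prime ⇒ `a ∈ P = ⟨x₃⟩ + B₀`
    have haL : a * L ∈ P := by
      have := Ideal.sub_mem _ hfP (hB₀P hb)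
      rwa [add_sub_cancel_left] at this
    have ha : a ∈ P := ((isPrime_span_X_image (R := K) _).mem_or_mem
      (by rwa [mul_comm] at haL)).resolve_left hL
    have hPsplit : P = Ideal.span {X i₃} ⊔ B₀ := by
      rw [hP, hB₀, ← Set.image_singleton, ← Ideal.span_union, ← Set.image_union]
      congr 2
      ext j
      simp only [Set.mem_union, Set.mem_insert_iff, Set.mem_singleton_iff]
      tauto
    rw [hPsplit] at ha
    obtain ⟨c, hc, b', hb', rfl⟩ := Submodule.mem_sup.mp ha
    obtain ⟨e, rfl⟩ := Ideal.mem_span_singleton'.mp hc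
    have e1 : b + (e * X i₃ + b') * L = b + b' * L + e * (X i₃ * L) := by ring
    rw [e1]
    exact Ideal.add_mem _ (Ideal.add_mem _ (hB₀l hb) (Ideal.mul_mem_right _ _ (hB₀l hb')))
      (Ideal.mul_mem_left _ _ (Ideal.mem_sup_left (Ideal.subset_span (by simp))))

end Prop61Flatness

/-! ## §5 Proposition 6.4: the central fibre of the `G(2,5)`-cone degeneration -/

section Prop64

variable {K : Type u} [Field K] {n : ℕ}

local notation "𝓗(" I ", " m ")" =>
  (((finrank K (homogeneousSubmodule (Fin (n + 1)) K m) - finrank K (idealDegree I m) : ℕ) : ℤ))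

variable (T : Finset (Fin (n + 1))) (i₀ i₁ i₂ i₃ : Fin (n + 1)) (p₁ p₂ : MvPolynomial (Fin (n + 1)) K)

/-- The limit ideal `I^{(0)} = ⟨p₁, p₂, x₀x₃, x₁x₃, x₂x₃⟩ + ⟨x_i : i ∈ T⟩` of Prop. 6.4 (`p₁ = x₀L₀₄ + x₁L₁₄ + x₂L₂₄`,
`p₂ = x₀L₀₅ + x₁L₁₅ + x₂L₂₅` the two substituted Plücker quadrics, `T = {k+4, …, 2k+1}`; here `p₁, p₂` are any elements and
`T` any set of coordinates). [cite: Kloosterman2025, Prop. 6.4 (proof)] -/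
def cubicLimitIdeal : Ideal (MvPolynomial (Fin (n + 1)) K) :=
  Ideal.span {p₁, p₂, X i₀ * X i₃, X i₁ * X i₃, X i₂ * X i₃} ⊔ Ideal.span (X '' (T : Set (Fin (n + 1))))

variable {T i₀ i₁ i₂ i₃ p₁ p₂}

/-- **"This is the intersection of two complete intersection ideals `⟨p₁, p₂, x₃⟩` and `⟨x₀, x₁, x₂⟩`"**:
`I^{(0)} = (⟨x₃, x_T⟩ + ⟨p₁, p₂⟩) ∩ ⟨x₀, x₁, x₂, x_T⟩` for all `p₁, p₂ ∈ ⟨x₀, x₁, x₂⟩`.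
[cite: Kloosterman2025, Prop. 6.4 (proof)] -/
theorem cubicLimitIdeal_eq_inf (hp₁ : p₁ ∈ Ideal.span {(X i₀ : MvPolynomial (Fin (n + 1)) K), X i₁, X i₂})
    (hp₂ : p₂ ∈ Ideal.span {(X i₀ : MvPolynomial (Fin (n + 1)) K), X i₁, X i₂})
    (h₀₃ : i₀ ≠ i₃) (h₁₃ : i₁ ≠ i₃) (h₂₃ : i₂ ≠ i₃) :
    cubicLimitIdeal T i₀ i₁ i₂ i₃ p₁ p₂ =
      (Ideal.span (X '' (({i₃} : Set (Fin (n + 1))) ∪ ↑T)) ⊔ Ideal.span {p₁, p₂}) ⊓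
        Ideal.span (X '' (({i₀, i₁, i₂} : Set (Fin (n + 1))) ∪ ↑T)) := by
  set A : Ideal (MvPolynomial (Fin (n + 1)) K) := Ideal.span (X '' (({i₀, i₁, i₂} : Set (Fin (n + 1))) ∪ ↑T))
    with hA
  set B₀ : Ideal (MvPolynomial (Fin (n + 1)) K) := Ideal.span (X '' (({i₃} : Set (Fin (n + 1))) ∪ ↑T)) with hB₀
  have hX : ∀ {s : Set (Fin (n + 1))} {i : Fin (n + 1)}, i ∈ s →
      (X i : MvPolynomial (Fin (n + 1)) K) ∈ Ideal.span (X '' s) :=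
    fun hi => Ideal.subset_span ⟨_, hi, rfl⟩
  have h3A : Ideal.span {(X i₀ : MvPolynomial (Fin (n + 1)) K), X i₁, X i₂} ≤ A := by
    refine Ideal.span_le.mpr ?_
    rintro y hy
    simp only [Set.mem_insert_iff, Set.mem_singleton_iff] at hy
    rcases hy with rfl | rfl | rfl
    · exact hX (Or.inl (Or.inl rfl))
    · exact hX (Or.inl (Or.inr (Or.inl rfl)))
    · exact hX (Or.inl (Or.inr (Or.inr rfl)))
  have hx₃B : (X i₃ : MvPolynomial (Fin (n + 1)) K) ∈ B₀ := hX (Or.inl rfl)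
  have hTA : Ideal.span (X '' (T : Set (Fin (n + 1)))) ≤ A := Ideal.span_mono (Set.image_mono Set.subset_union_right)
  have hTB : Ideal.span (X '' (T : Set (Fin (n + 1)))) ≤ B₀ := Ideal.span_mono (Set.image_mono Set.subset_union_right)
  have h12A : Ideal.span {p₁, p₂} ≤ A := by
    refine Ideal.span_le.mpr ?_
    rintro y hy
    simp only [Set.mem_insert_iff, Set.mem_singleton_iff] at hy
    rcases hy with rfl | rfl
    · exact h3A hp₁
    · exact h3A hp₂
  refine le_antisymm ?_ ?_
  · refine sup_le (Ideal.span_le.mpr ?_) (le_inf (hTB.trans le_sup_left) hTA)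
    rintro y hy
    simp only [Set.mem_insert_iff, Set.mem_singleton_iff] at hy
    rcases hy with rfl | rfl | rfl | rfl | rfl
    · exact ⟨Ideal.mem_sup_right (Ideal.subset_span (by simp)), h3A hp₁⟩
    · exact ⟨Ideal.mem_sup_right (Ideal.subset_span (by simp)), h3A hp₂⟩
    · exact ⟨Ideal.mem_sup_left (Ideal.mul_mem_left _ _ hx₃B), Ideal.mul_mem_right _ _ (hX (Or.inl (Or.inl rfl)))⟩
    · exact ⟨Ideal.mem_sup_left (Ideal.mul_mem_left _ _ hx₃B),
        Ideal.mul_mem_right _ _ (hX (Or.inl (Or.inr (Or.inl rfl))))⟩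
    · exact ⟨Ideal.mem_sup_left (Ideal.mul_mem_left _ _ hx₃B),
        Ideal.mul_mem_right _ _ (hX (Or.inl (Or.inr (Or.inr rfl))))⟩
  · rintro f ⟨hfB, hfA⟩
    obtain ⟨b, hb, s, hs, rfl⟩ := Submodule.mem_sup.mp hfB
    have hbA : b ∈ A := by
      have := Ideal.sub_mem _ hfA (h12A hs)
      rwa [add_sub_cancel_right] at this
    have hdisj : Disjoint ({i₀, i₁, i₂} : Set (Fin (n + 1))) {i₃} := by
      rw [Set.disjoint_singleton_right]
      rintro (h | h | h)
      · exact h₀₃ h.symm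
      · exact h₁₃ h.symm
      · exact h₂₃ h.symm
    have hb' := (span_X_inf_span_X_eq (K := K) (T : Set (Fin (n + 1))) hdisj).le ⟨hbA, hb⟩
    refine Ideal.add_mem _ ?_ (Ideal.mem_sup_left (Ideal.span_mono (by
      intro y hy
      simp only [Set.mem_insert_iff, Set.mem_singleton_iff] at hy ⊢
      tauto) hs))
    refine (sup_le le_sup_right (Ideal.span_le.mpr ?_) : _ ≤ cubicLimitIdeal T i₀ i₁ i₂ i₃ p₁ p₂) hb'
    rintro _ ⟨⟨a, b⟩, ⟨ha, hb⟩, rfl⟩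
    simp only [Set.mem_insert_iff, Set.mem_singleton_iff] at ha hb
    subst hb
    refine Ideal.mem_sup_left (Ideal.subset_span ?_)
    rcases ha with rfl | rfl | rfl
    · simp
    · simp
    · simp

/-- The binomial identity behind the central fibre of Prop. 6.4: with `c = χ_{w+3}`,
`(c − 2c(·−2) + c(·−4)) + χ_{w+1} − χ_w = χ_{w+1} + 3χ_{w+1}(·−1) + χ_{w+1}(·−2)`, i.e.
`(1+s)²(1−s) + (1−s)² − (1−s)³ … = 1 + 3s + s²` over `(1−s)^{w+1}`. [folklore] -/
private theorem chi_cubic_limit_identity {w : ℕ} (hw : 1 ≤ w) (z : ℤ) :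
    chi (w + 3) z - 2 * chi (w + 3) (z - 2) + chi (w + 3) (z - 4) + chi (w + 1) z - chi w z =
      chi (w + 1) z + 3 * chi (w + 1) (z - 1) + chi (w + 1) (z - 2) := by
  have h0 : ∀ y, chi w y = chi (w + 1) y - chi (w + 1) (y - 1) :=
    fun y => (chi_succ_sub_chi_succ_pred hw y).symm
  have h1 : ∀ y, chi (w + 1) y = chi (w + 2) y - chi (w + 2) (y - 1) :=
    fun y => (chi_succ_sub_chi_succ_pred (v := w + 1) (by omega) y).symm
  have h2 : ∀ y, chi (w + 2) y = chi (w + 3) y - chi (w + 3) (y - 1) :=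
    fun y => (chi_succ_sub_chi_succ_pred (v := w + 2) (by omega) y).symm
  rw [h0]
  simp only [h1]
  simp only [h2]
  ring_nf

/-- **The Hilbert function of the central fibre of Prop. 6.4** ("one easily checks that the Hilbert function of `I^{(0)}`
coincide with the Hilbert function of `I^{(t)}` for `t ≠ 0`" — the `I^{(0)}` side): if `⟨x₃, x_T, p₁, p₂⟩` is a complete
intersection of multidegree `(1, …, 1, 2, 2)` (`p₁ ∉ ⟨x₃, x_T⟩`, `p₂` a non-zero-divisor modulo `⟨x₃, x_T, p₁⟩`), then with
`v = n + 1 − |T|`: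
`h_{I^{(0)}}(m) = (χ_{v−1}(m) − 2χ_{v−1}(m−2) + χ_{v−1}(m−4)) + χ_{v−3}(m) − χ_{v−4}(m)`
(`CI(2,2)` in `V(x₃,x_T)` + plane `V(x₀,x₁,x₂,x_T)` − common hyperplane `V(x₀,…,x₃,x_T)`).
[cite: Kloosterman2025, Prop. 6.4 (proof)] -/
theorem hilbert_cubicLimitIdeal (h₀₁ : i₀ ≠ i₁) (h₀₂ : i₀ ≠ i₂) (h₀₃ : i₀ ≠ i₃) (h₁₂ : i₁ ≠ i₂) (h₁₃ : i₁ ≠ i₃)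
    (h₂₃ : i₂ ≠ i₃) (hi₀ : i₀ ∉ T) (hi₁ : i₁ ∉ T) (hi₂ : i₂ ∉ T) (hi₃ : i₃ ∉ T)
    (hp₁A : p₁ ∈ Ideal.span {(X i₀ : MvPolynomial (Fin (n + 1)) K), X i₁, X i₂})
    (hp₂A : p₂ ∈ Ideal.span {(X i₀ : MvPolynomial (Fin (n + 1)) K), X i₁, X i₂})
    (hp₁h : p₁.IsHomogeneous 2) (hp₂h : p₂.IsHomogeneous 2)
    (hp₁ : p₁ ∉ Ideal.span (X '' (({i₃} : Set (Fin (n + 1))) ∪ ↑T)))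
    (hp₂ : ∀ u, p₂ * u ∈ Ideal.span (X '' (({i₃} : Set (Fin (n + 1))) ∪ ↑T)) ⊔ Ideal.span {p₁} →
      u ∈ Ideal.span (X '' (({i₃} : Set (Fin (n + 1))) ∪ ↑T)) ⊔ Ideal.span {p₁})
    (hT : T.card + 4 ≤ n) (m : ℕ) :
    𝓗(cubicLimitIdeal T i₀ i₁ i₂ i₃ p₁ p₂, m) =
      (chi (n - T.card) m - 2 * chi (n - T.card) ((m : ℤ) - 2) + chi (n - T.card) ((m : ℤ) - 4)) +
        chi (n - 2 - T.card) m - chi (n - 3 - T.card) m := by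
  set A : Ideal (MvPolynomial (Fin (n + 1)) K) := Ideal.span (X '' (({i₀, i₁, i₂} : Set (Fin (n + 1))) ∪ ↑T))
    with hA
  set B₀ : Ideal (MvPolynomial (Fin (n + 1)) K) := Ideal.span (X '' (({i₃} : Set (Fin (n + 1))) ∪ ↑T)) with hB₀
  have hAh : A.IsHomogeneous (homogeneousSubmodule (Fin (n + 1)) K) := isHomogeneous_span_X_image _
  have hB₀h : B₀.IsHomogeneous (homogeneousSubmodule (Fin (n + 1)) K) := isHomogeneous_span_X_image _
  have hB₁h : (B₀ ⊔ Ideal.span {p₁}).IsHomogeneous (homogeneousSubmodule (Fin (n + 1)) K) :=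
    hB₀h.sup (Ideal.homogeneous_span _ _ fun x hx => by
      rw [Set.mem_singleton_iff] at hx
      exact hx ▸ ⟨2, hp₁h⟩)
  have hBh : (B₀ ⊔ Ideal.span {p₁, p₂}).IsHomogeneous (homogeneousSubmodule (Fin (n + 1)) K) :=
    hB₀h.sup (Ideal.homogeneous_span _ _ fun x hx => by
      simp only [Set.mem_insert_iff, Set.mem_singleton_iff] at hx
      rcases hx with rfl | rfl
      · exact ⟨2, hp₁h⟩
      · exact ⟨2, hp₂h⟩)
  have hcardA : (insert i₀ (insert i₁ (insert i₂ T))).card = T.card + 3 := by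
    rw [Finset.card_insert_of_notMem (by simp [h₀₁, h₀₂, hi₀]), Finset.card_insert_of_notMem (by simp [h₁₂, hi₁]),
      Finset.card_insert_of_notMem hi₂]
  have hcardB : (insert i₃ T).card = T.card + 1 := by rw [Finset.card_insert_of_notMem hi₃]
  have hcardAB : (insert i₀ (insert i₁ (insert i₂ (insert i₃ T)))).card = T.card + 4 := by
    rw [Finset.card_insert_of_notMem (by simp [h₀₁, h₀₂, h₀₃, hi₀]),
      Finset.card_insert_of_notMem (by simp [h₁₂, h₁₃, hi₁]), Finset.card_insert_of_notMem (by simp [h₂₃, hi₂]),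
      Finset.card_insert_of_notMem hi₃]
  have hHA : ∀ m : ℕ, 𝓗(A, m) = chi (n - 2 - T.card) m := by
    intro m
    have h := hilbert_span_X_image_eq_chi (K := K) (insert i₀ (insert i₁ (insert i₂ T))) (by omega) m
    rw [coe_insert_insert_insert_eq, hcardA] at h
    rw [hA, h]
    congr 1
    omega
  have hHB₀ : ∀ m : ℕ, 𝓗(B₀, m) = chi (n - T.card) m := by
    intro m
    have h := hilbert_span_X_image_eq_chi (K := K) (insert i₃ T) (by omega) m
    rw [coe_insert_eq, hcardB] at h
    rw [hB₀, h]
    congr 1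
    omega
  have hp₁0 : p₁ ≠ 0 := fun h => hp₁ (by rw [h]; exact Submodule.zero_mem _)
  have hHB₁ : ∀ m : ℕ, 𝓗(B₀ ⊔ Ideal.span {p₁}, m) = chi (n - T.card) m - chi (n - T.card) ((m : ℤ) - 2) := by
    intro m
    rw [hilb_sup_span_eq hB₀h hp₁0 hp₁h (mem_of_mul_mem_span_X_image hp₁) (fun z hz => chi_of_neg _ hz) hHB₀ m,
      Nat.cast_ofNat]
  have h1 : (1 : MvPolynomial (Fin (n + 1)) K) ∉ B₀ ⊔ Ideal.span {p₁} :=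
    one_notMem_of_le_ker (sup_le (span_X_image_le_ker _) (span_singleton_le_ker hp₁h two_pos))
  have hp₂0 : p₂ ≠ 0 := ne_zero_of_nzd h1 hp₂
  have hHB : ∀ m : ℕ, 𝓗(B₀ ⊔ Ideal.span {p₁, p₂}, m) =
      chi (n - T.card) m - 2 * chi (n - T.card) ((m : ℤ) - 2) + chi (n - T.card) ((m : ℤ) - 4) := by
    intro m
    have e : B₀ ⊔ Ideal.span {p₁, p₂} = (B₀ ⊔ Ideal.span {p₁}) ⊔ Ideal.span {p₂} := by
      rw [Ideal.span_insert, sup_assoc]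
    rw [e, hilb_sup_span_eq hB₁h hp₂0 hp₂h hp₂ (g := fun z => chi (n - T.card) z - chi (n - T.card) (z - 2))
      (fun z hz => by rw [chi_of_neg _ hz, chi_of_neg _ (by omega), sub_zero]) hHB₁ m]
    ring_nf
  have hsup : (B₀ ⊔ Ideal.span {p₁, p₂}) ⊔ A =
      Ideal.span (X '' ((insert i₀ (insert i₁ (insert i₂ (insert i₃ T))) : Finset (Fin (n + 1))) :
        Set (Fin (n + 1)))) := by
    have h12A : Ideal.span {p₁, p₂} ≤ A := by
      refine Ideal.span_le.mpr ?_
      rintro y hy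
      simp only [Set.mem_insert_iff, Set.mem_singleton_iff] at hy
      have h3A : Ideal.span {(X i₀ : MvPolynomial (Fin (n + 1)) K), X i₁, X i₂} ≤ A :=
        Ideal.span_mono (by
          rintro z hz
          simp only [Set.mem_insert_iff, Set.mem_singleton_iff] at hz
          rcases hz with rfl | rfl | rfl
          · exact ⟨i₀, Or.inl (Or.inl rfl), rfl⟩
          · exact ⟨i₁, Or.inl (Or.inr (Or.inl rfl)), rfl⟩
          · exact ⟨i₂, Or.inl (Or.inr (Or.inr rfl)), rfl⟩)
      rcases hy with rfl | rfl
      · exact h3A hp₁A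
      · exact h3A hp₂A
    rw [sup_assoc, sup_eq_right.mpr h12A, hB₀, hA, ← Ideal.span_union, ← Set.image_union, Finset.coe_insert,
      Finset.coe_insert, Finset.coe_insert, Finset.coe_insert]
    congr 2
    ext j
    simp only [Set.mem_union, Set.mem_insert_iff, Set.mem_singleton_iff, Finset.mem_coe]
    tauto
  have hHAB : ∀ m : ℕ, 𝓗((B₀ ⊔ Ideal.span {p₁, p₂}) ⊔ A, m) = chi (n - 3 - T.card) m := by
    intro m
    rw [hsup, hilbert_span_X_image_eq_chi (K := K) _ (by omega) m, hcardAB]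
    congr 1
    omega
  rw [cubicLimitIdeal_eq_inf hp₁A hp₂A h₀₃ h₁₃ h₂₃, hilb_inf_eq hBh hAh m, hHB, hHA, hHAB]

/-- **The central fibre of Prop. 6.4 has the Hilbert function of a `k`-dimensional linear section of the cone over
`G(2,5) ⊂ ℙ⁹`**: under the hypotheses of `hilbert_cubicLimitIdeal`,
`h_{I^{(0)}}(m) = χ_{v−3}(m) + 3χ_{v−3}(m−1) + χ_{v−3}(m−2)`, i.e. Hilbert series `(1 + 3s + s²)/(1 − s)^{v−3}`
(`v − 3 = k + 1` in the printed case `n = 2k+1`, `|T| = k − 2`): `h`-vector `(1,3,1)`, degree `5 = deg G(2,5)`. The equality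
with `h_{I^{(t)}}`, `t ≠ 0` (the postulation of the Plücker ideal) is the part NOT formalised here.
[cite: Kloosterman2025, Prop. 6.4 (proof)] -/
theorem hilbert_cubicLimitIdeal_eq_grassmannSection (h₀₁ : i₀ ≠ i₁) (h₀₂ : i₀ ≠ i₂) (h₀₃ : i₀ ≠ i₃) (h₁₂ : i₁ ≠ i₂)
    (h₁₃ : i₁ ≠ i₃) (h₂₃ : i₂ ≠ i₃) (hi₀ : i₀ ∉ T) (hi₁ : i₁ ∉ T) (hi₂ : i₂ ∉ T) (hi₃ : i₃ ∉ T)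
    (hp₁A : p₁ ∈ Ideal.span {(X i₀ : MvPolynomial (Fin (n + 1)) K), X i₁, X i₂})
    (hp₂A : p₂ ∈ Ideal.span {(X i₀ : MvPolynomial (Fin (n + 1)) K), X i₁, X i₂})
    (hp₁h : p₁.IsHomogeneous 2) (hp₂h : p₂.IsHomogeneous 2)
    (hp₁ : p₁ ∉ Ideal.span (X '' (({i₃} : Set (Fin (n + 1))) ∪ ↑T)))
    (hp₂ : ∀ u, p₂ * u ∈ Ideal.span (X '' (({i₃} : Set (Fin (n + 1))) ∪ ↑T)) ⊔ Ideal.span {p₁} →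
      u ∈ Ideal.span (X '' (({i₃} : Set (Fin (n + 1))) ∪ ↑T)) ⊔ Ideal.span {p₁})
    (hT : T.card + 4 ≤ n) (m : ℕ) :
    𝓗(cubicLimitIdeal T i₀ i₁ i₂ i₃ p₁ p₂, m) =
      chi (n - 2 - T.card) m + 3 * chi (n - 2 - T.card) ((m : ℤ) - 1) + chi (n - 2 - T.card) ((m : ℤ) - 2) := by
  rw [hilbert_cubicLimitIdeal h₀₁ h₀₂ h₀₃ h₁₂ h₁₃ h₂₃ hi₀ hi₁ hi₂ hi₃ hp₁A hp₂A hp₁h hp₂h hp₁ hp₂ hT m]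
  obtain ⟨w, hw⟩ : ∃ w, n - 3 - T.card = w := ⟨_, rfl⟩
  rw [hw, show n - T.card = w + 3 by omega, show n - 2 - T.card = w + 1 by omega]
  exact chi_cubic_limit_identity (by omega) m

end Prop64

/-! ## §6 Remark 6.7: the central fibre of the quartic-scroll degeneration (`L₀₃ = 0`) -/

section Rem67

variable {K : Type u} [Field K] {n : ℕ}

local notation "𝓗(" I ", " m ")" =>
  (((finrank K (homogeneousSubmodule (Fin (n + 1)) K m) - finrank K (idealDegree I m) : ℕ) : ℤ))

variable (T : Finset (Fin (n + 1))) (i₀ i₁ i₃ i₄ : Fin (n + 1)) (N M : MvPolynomial (Fin (n + 1)) K)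

/-- The limit `t → 0` of the ideal `I_t` of `2 × 2` minors of Remark 6.7:
`⟨x₀x₃, x₀x₄, x₁x₃, x₁x₄, N, M⟩ + ⟨x_i : i ∈ T⟩` with `N = x₀L₀₅ + x₁L₁₅`, `M = x₃L₂₃ + x₄L₂₄` (here any elements).
[cite: Kloosterman2025, Remark 6.7] -/
def scrollLimitIdeal : Ideal (MvPolynomial (Fin (n + 1)) K) :=
  Ideal.span {X i₀ * X i₃, X i₀ * X i₄, X i₁ * X i₃, X i₁ * X i₄, N, M} ⊔ Ideal.span (X '' (T : Set (Fin (n + 1))))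

variable {T i₀ i₁ i₃ i₄ N M}

/-- **"which is the intersection of `(x₀, x₁, x₃L₂₃ + x₄L₂₄)` and `(x₃, x₄, x₀L₀₅ + x₁L₁₅)`"**: for `N ∈ ⟨x₀, x₁⟩`,
`M ∈ ⟨x₃, x₄⟩`, the limit ideal is `(⟨x₀, x₁, x_T⟩ + ⟨M⟩) ∩ (⟨x₃, x₄, x_T⟩ + ⟨N⟩)` — two quadric cones of class `h − [Πᵢ]`
each. [cite: Kloosterman2025, Remark 6.7] -/
theorem scrollLimitIdeal_eq_inf (hN : N ∈ Ideal.span {(X i₀ : MvPolynomial (Fin (n + 1)) K), X i₁})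
    (hM : M ∈ Ideal.span {(X i₃ : MvPolynomial (Fin (n + 1)) K), X i₄})
    (h₀₃ : i₀ ≠ i₃) (h₀₄ : i₀ ≠ i₄) (h₁₃ : i₁ ≠ i₃) (h₁₄ : i₁ ≠ i₄) :
    scrollLimitIdeal T i₀ i₁ i₃ i₄ N M =
      (Ideal.span (X '' (({i₀, i₁} : Set (Fin (n + 1))) ∪ ↑T)) ⊔ Ideal.span {M}) ⊓
        (Ideal.span (X '' (({i₃, i₄} : Set (Fin (n + 1))) ∪ ↑T)) ⊔ Ideal.span {N}) := by
  set A₀ : Ideal (MvPolynomial (Fin (n + 1)) K) := Ideal.span (X '' (({i₀, i₁} : Set (Fin (n + 1))) ∪ ↑T)) with hA₀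
  set B₀ : Ideal (MvPolynomial (Fin (n + 1)) K) := Ideal.span (X '' (({i₃, i₄} : Set (Fin (n + 1))) ∪ ↑T)) with hB₀
  have hX : ∀ {s : Set (Fin (n + 1))} {i : Fin (n + 1)}, i ∈ s →
      (X i : MvPolynomial (Fin (n + 1)) K) ∈ Ideal.span (X '' s) :=
    fun hi => Ideal.subset_span ⟨_, hi, rfl⟩
  have hx₀ : (X i₀ : MvPolynomial (Fin (n + 1)) K) ∈ A₀ := hX (Or.inl (Or.inl rfl))
  have hx₁ : (X i₁ : MvPolynomial (Fin (n + 1)) K) ∈ A₀ := hX (Or.inl (Or.inr rfl))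
  have hx₃ : (X i₃ : MvPolynomial (Fin (n + 1)) K) ∈ B₀ := hX (Or.inl (Or.inl rfl))
  have hx₄ : (X i₄ : MvPolynomial (Fin (n + 1)) K) ∈ B₀ := hX (Or.inl (Or.inr rfl))
  have hNA : N ∈ A₀ := (Ideal.span_le.mpr (by
    rintro y hy
    simp only [Set.mem_insert_iff, Set.mem_singleton_iff] at hy
    rcases hy with rfl | rfl
    · exact hx₀
    · exact hx₁) : Ideal.span {(X i₀ : MvPolynomial (Fin (n + 1)) K), X i₁} ≤ A₀) hN
  have hMB : M ∈ B₀ := (Ideal.span_le.mpr (by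
    rintro y hy
    simp only [Set.mem_insert_iff, Set.mem_singleton_iff] at hy
    rcases hy with rfl | rfl
    · exact hx₃
    · exact hx₄) : Ideal.span {(X i₃ : MvPolynomial (Fin (n + 1)) K), X i₄} ≤ B₀) hM
  have hTA : Ideal.span (X '' (T : Set (Fin (n + 1)))) ≤ A₀ := Ideal.span_mono (Set.image_mono Set.subset_union_right)
  have hTB : Ideal.span (X '' (T : Set (Fin (n + 1)))) ≤ B₀ := Ideal.span_mono (Set.image_mono Set.subset_union_right)
  refine le_antisymm ?_ ?_
  · refine sup_le (Ideal.span_le.mpr ?_) (le_inf (hTA.trans le_sup_left) (hTB.trans le_sup_left))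
    rintro y hy
    simp only [Set.mem_insert_iff, Set.mem_singleton_iff] at hy
    rcases hy with rfl | rfl | rfl | rfl | rfl | rfl
    · exact ⟨Ideal.mem_sup_left (Ideal.mul_mem_right _ _ hx₀), Ideal.mem_sup_left (Ideal.mul_mem_left _ _ hx₃)⟩
    · exact ⟨Ideal.mem_sup_left (Ideal.mul_mem_right _ _ hx₀), Ideal.mem_sup_left (Ideal.mul_mem_left _ _ hx₄)⟩
    · exact ⟨Ideal.mem_sup_left (Ideal.mul_mem_right _ _ hx₁), Ideal.mem_sup_left (Ideal.mul_mem_left _ _ hx₃)⟩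
    · exact ⟨Ideal.mem_sup_left (Ideal.mul_mem_right _ _ hx₁), Ideal.mem_sup_left (Ideal.mul_mem_left _ _ hx₄)⟩
    · exact ⟨Ideal.mem_sup_left hNA, Ideal.mem_sup_right (Ideal.subset_span rfl)⟩
    · exact ⟨Ideal.mem_sup_right (Ideal.subset_span rfl), Ideal.mem_sup_left hMB⟩
  · rintro f ⟨hfA, hfB⟩
    obtain ⟨a, ha, s, hs, rfl⟩ := Submodule.mem_sup.mp hfA
    obtain ⟨b, hb, r, hr, hf⟩ := Submodule.mem_sup.mp hfB
    -- `a − r = b − s ∈ A₀ ∩ B₀ = ⟨x_T⟩ + ⟨x₀x₃, x₀x₄, x₁x₃, x₁x₄⟩`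
    have hsB : s ∈ B₀ := (Ideal.span_singleton_le_iff_mem _ |>.mpr hMB) hs
    have hrA : r ∈ A₀ := (Ideal.span_singleton_le_iff_mem _ |>.mpr hNA) hr
    have har : a - r ∈ A₀ ⊓ B₀ := by
      refine ⟨Ideal.sub_mem _ ha hrA, ?_⟩
      have e : a - r = b - s := by linear_combination -hf
      rw [e]
      exact Ideal.sub_mem _ hb hsB
    have hdisj : Disjoint ({i₀, i₁} : Set (Fin (n + 1))) {i₃, i₄} := by
      rw [Set.disjoint_iff_forall_ne]
      rintro a (rfl | rfl) b (rfl | rfl)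
      · exact h₀₃
      · exact h₀₄
      · exact h₁₃
      · exact h₁₄
    have har' := (span_X_inf_span_X_eq (K := K) (T : Set (Fin (n + 1))) hdisj).le har
    have e : a + s = (a - r) + r + s := by ring
    rw [e]
    refine Ideal.add_mem _ (Ideal.add_mem _ ?_ (Ideal.mem_sup_left ((Ideal.span_singleton_le_iff_mem _).mpr
      (Ideal.subset_span (by simp)) hr))) (Ideal.mem_sup_left ((Ideal.span_singleton_le_iff_mem _).mpr
      (Ideal.subset_span (by simp)) hs))
    refine (sup_le le_sup_right (Ideal.span_le.mpr ?_) : _ ≤ scrollLimitIdeal T i₀ i₁ i₃ i₄ N M) har'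
    rintro _ ⟨⟨a, b⟩, ⟨ha, hb⟩, rfl⟩
    simp only [Set.mem_insert_iff, Set.mem_singleton_iff] at ha hb
    refine Ideal.mem_sup_left (Ideal.subset_span ?_)
    rcases ha with rfl | rfl <;> rcases hb with rfl | rfl <;> simp

/-- The binomial identity behind the central fibre of Remark 6.7: with `c = χ_{w+2}`,
`2(c − c(·−2)) − χ_w = χ_{w+1} + 3χ_{w+1}(·−1)`, i.e. `2(1+s) − (1−s) = 1 + 3s` over `(1−s)^{w+1}`. [folklore] -/
private theorem chi_scroll_limit_identity {w : ℕ} (hw : 1 ≤ w) (z : ℤ) :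
    2 * (chi (w + 2) z - chi (w + 2) (z - 2)) - chi w z = chi (w + 1) z + 3 * chi (w + 1) (z - 1) := by
  have h0 : ∀ y, chi w y = chi (w + 1) y - chi (w + 1) (y - 1) :=
    fun y => (chi_succ_sub_chi_succ_pred hw y).symm
  have h1 : ∀ y, chi (w + 1) y = chi (w + 2) y - chi (w + 2) (y - 1) :=
    fun y => (chi_succ_sub_chi_succ_pred (v := w + 1) (by omega) y).symm
  rw [h0]
  simp only [h1]
  ring_nf

/-- **The Hilbert function of the central fibre of Remark 6.7**: if the two components `⟨x₀, x₁, x_T, M⟩`,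
`⟨x₃, x₄, x_T, N⟩` are complete intersections (`M ∉ ⟨x₀, x₁, x_T⟩`, `N ∉ ⟨x₃, x₄, x_T⟩`; `N ∈ ⟨x₀,x₁⟩`, `M ∈ ⟨x₃,x₄⟩`
quadrics), then with `v = n + 1 − |T|`:
`h(m) = 2(χ_{v−2}(m) − χ_{v−2}(m−2)) − χ_{v−4}(m)`. [cite: Kloosterman2025, Remark 6.7] -/
theorem hilbert_scrollLimitIdeal (h₀₁ : i₀ ≠ i₁) (h₀₃ : i₀ ≠ i₃) (h₀₄ : i₀ ≠ i₄) (h₁₃ : i₁ ≠ i₃) (h₁₄ : i₁ ≠ i₄)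
    (h₃₄ : i₃ ≠ i₄) (hi₀ : i₀ ∉ T) (hi₁ : i₁ ∉ T) (hi₃ : i₃ ∉ T) (hi₄ : i₄ ∉ T)
    (hNA : N ∈ Ideal.span {(X i₀ : MvPolynomial (Fin (n + 1)) K), X i₁})
    (hMB : M ∈ Ideal.span {(X i₃ : MvPolynomial (Fin (n + 1)) K), X i₄})
    (hNh : N.IsHomogeneous 2) (hMh : M.IsHomogeneous 2)
    (hM : M ∉ Ideal.span (X '' (({i₀, i₁} : Set (Fin (n + 1))) ∪ ↑T)))
    (hN : N ∉ Ideal.span (X '' (({i₃, i₄} : Set (Fin (n + 1))) ∪ ↑T)))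
    (hT : T.card + 4 ≤ n) (m : ℕ) :
    𝓗(scrollLimitIdeal T i₀ i₁ i₃ i₄ N M, m) =
      2 * (chi (n - 1 - T.card) m - chi (n - 1 - T.card) ((m : ℤ) - 2)) - chi (n - 3 - T.card) m := by
  set A₀ : Ideal (MvPolynomial (Fin (n + 1)) K) := Ideal.span (X '' (({i₀, i₁} : Set (Fin (n + 1))) ∪ ↑T)) with hA₀
  set B₀ : Ideal (MvPolynomial (Fin (n + 1)) K) := Ideal.span (X '' (({i₃, i₄} : Set (Fin (n + 1))) ∪ ↑T)) with hB₀
  have hA₀h : A₀.IsHomogeneous (homogeneousSubmodule (Fin (n + 1)) K) := isHomogeneous_span_X_image _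
  have hB₀h : B₀.IsHomogeneous (homogeneousSubmodule (Fin (n + 1)) K) := isHomogeneous_span_X_image _
  have hsing : ∀ {Q : MvPolynomial (Fin (n + 1)) K}, Q.IsHomogeneous 2 →
      (Ideal.span {Q}).IsHomogeneous (homogeneousSubmodule (Fin (n + 1)) K) :=
    fun hQ => Ideal.homogeneous_span _ _ fun x hx => by
      rw [Set.mem_singleton_iff] at hx
      exact hx ▸ ⟨2, hQ⟩
  have hAh : (A₀ ⊔ Ideal.span {M}).IsHomogeneous (homogeneousSubmodule (Fin (n + 1)) K) := hA₀h.sup (hsing hMh)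
  have hBh : (B₀ ⊔ Ideal.span {N}).IsHomogeneous (homogeneousSubmodule (Fin (n + 1)) K) := hB₀h.sup (hsing hNh)
  have hcardA : (insert i₀ (insert i₁ T)).card = T.card + 2 := by
    rw [Finset.card_insert_of_notMem (by simp [h₀₁, hi₀]), Finset.card_insert_of_notMem hi₁]
  have hcardB : (insert i₃ (insert i₄ T)).card = T.card + 2 := by
    rw [Finset.card_insert_of_notMem (by simp [h₃₄, hi₃]), Finset.card_insert_of_notMem hi₄]
  have hcardAB : (insert i₀ (insert i₁ (insert i₃ (insert i₄ T)))).card = T.card + 4 := by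
    rw [Finset.card_insert_of_notMem (by simp [h₀₁, h₀₃, h₀₄, hi₀]),
      Finset.card_insert_of_notMem (by simp [h₁₃, h₁₄, hi₁]), Finset.card_insert_of_notMem (by simp [h₃₄, hi₃]),
      Finset.card_insert_of_notMem hi₄]
  have hHA₀ : ∀ m : ℕ, 𝓗(A₀, m) = chi (n - 1 - T.card) m := by
    intro m
    have h := hilbert_span_X_image_eq_chi (K := K) (insert i₀ (insert i₁ T)) (by omega) m
    rw [coe_insert_insert_eq, hcardA] at h
    rw [hA₀, h]
    congr 1
    omega
  have hHB₀ : ∀ m : ℕ, 𝓗(B₀, m) = chi (n - 1 - T.card) m := by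
    intro m
    have h := hilbert_span_X_image_eq_chi (K := K) (insert i₃ (insert i₄ T)) (by omega) m
    rw [coe_insert_insert_eq, hcardB] at h
    rw [hB₀, h]
    congr 1
    omega
  have hM0 : M ≠ 0 := fun h => hM (by rw [h]; exact Submodule.zero_mem _)
  have hN0 : N ≠ 0 := fun h => hN (by rw [h]; exact Submodule.zero_mem _)
  have hHA : ∀ m : ℕ, 𝓗(A₀ ⊔ Ideal.span {M}, m) = chi (n - 1 - T.card) m - chi (n - 1 - T.card) ((m : ℤ) - 2) := by
    intro m
    rw [hilb_sup_span_eq hA₀h hM0 hMh (mem_of_mul_mem_span_X_image hM) (fun z hz => chi_of_neg _ hz) hHA₀ m,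
      Nat.cast_ofNat]
  have hHB : ∀ m : ℕ, 𝓗(B₀ ⊔ Ideal.span {N}, m) = chi (n - 1 - T.card) m - chi (n - 1 - T.card) ((m : ℤ) - 2) := by
    intro m
    rw [hilb_sup_span_eq hB₀h hN0 hNh (mem_of_mul_mem_span_X_image hN) (fun z hz => chi_of_neg _ hz) hHB₀ m,
      Nat.cast_ofNat]
  have hNA₀ : N ∈ A₀ := (Ideal.span_le.mpr (by
    rintro y hy
    simp only [Set.mem_insert_iff, Set.mem_singleton_iff] at hy
    rcases hy with rfl | rfl
    · exact Ideal.subset_span ⟨i₀, Or.inl (Or.inl rfl), rfl⟩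
    · exact Ideal.subset_span ⟨i₁, Or.inl (Or.inr rfl), rfl⟩) :
      Ideal.span {(X i₀ : MvPolynomial (Fin (n + 1)) K), X i₁} ≤ A₀) hNA
  have hMB₀ : M ∈ B₀ := (Ideal.span_le.mpr (by
    rintro y hy
    simp only [Set.mem_insert_iff, Set.mem_singleton_iff] at hy
    rcases hy with rfl | rfl
    · exact Ideal.subset_span ⟨i₃, Or.inl (Or.inl rfl), rfl⟩
    · exact Ideal.subset_span ⟨i₄, Or.inl (Or.inr rfl), rfl⟩) :
      Ideal.span {(X i₃ : MvPolynomial (Fin (n + 1)) K), X i₄} ≤ B₀) hMB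
  have hsup : (A₀ ⊔ Ideal.span {M}) ⊔ (B₀ ⊔ Ideal.span {N}) =
      Ideal.span (X '' ((insert i₀ (insert i₁ (insert i₃ (insert i₄ T))) : Finset (Fin (n + 1))) :
        Set (Fin (n + 1)))) := by
    have e1 : (A₀ ⊔ Ideal.span {M}) ⊔ (B₀ ⊔ Ideal.span {N}) = A₀ ⊔ B₀ :=
      le_antisymm
        (sup_le (sup_le le_sup_left (((Ideal.span_singleton_le_iff_mem _).mpr hMB₀).trans le_sup_right))
          (sup_le le_sup_right (((Ideal.span_singleton_le_iff_mem _).mpr hNA₀).trans le_sup_left)))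
        (sup_le (le_sup_left.trans le_sup_left) (le_sup_left.trans le_sup_right))
    rw [e1, hA₀, hB₀, ← Ideal.span_union, ← Set.image_union, Finset.coe_insert, Finset.coe_insert, Finset.coe_insert,
      Finset.coe_insert]
    congr 2
    ext j
    simp only [Set.mem_union, Set.mem_insert_iff, Set.mem_singleton_iff, Finset.mem_coe]
    tauto
  have hHAB : ∀ m : ℕ, 𝓗((A₀ ⊔ Ideal.span {M}) ⊔ (B₀ ⊔ Ideal.span {N}), m) = chi (n - 3 - T.card) m := by
    intro m
    rw [hsup, hilbert_span_X_image_eq_chi (K := K) _ (by omega) m, hcardAB]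
    congr 1
    omega
  rw [scrollLimitIdeal_eq_inf hNA hMB h₀₃ h₀₄ h₁₃ h₁₄, hilb_inf_eq hAh hBh m, hHA, hHB, hHAB]
  ring

/-- **The central fibre of Remark 6.7 has the Hilbert function of a quartic scroll section**: under the hypotheses of
`hilbert_scrollLimitIdeal`, `h(m) = χ_{v−3}(m) + 3χ_{v−3}(m−1)`, Hilbert series `(1 + 3s)/(1 − s)^{v−3}` — `h`-vector
`(1,3)`, degree `4` ("a degeneration of a quartic subscheme, whereas in the above proof we used a quintic subscheme").
The postulation of the general fibre (the `2 × 2` minors of `A_t`) is not formalised here. [cite: Kloosterman2025, Remark 6.7] -/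
theorem hilbert_scrollLimitIdeal_eq_scrollSection (h₀₁ : i₀ ≠ i₁) (h₀₃ : i₀ ≠ i₃) (h₀₄ : i₀ ≠ i₄) (h₁₃ : i₁ ≠ i₃)
    (h₁₄ : i₁ ≠ i₄) (h₃₄ : i₃ ≠ i₄) (hi₀ : i₀ ∉ T) (hi₁ : i₁ ∉ T) (hi₃ : i₃ ∉ T) (hi₄ : i₄ ∉ T)
    (hNA : N ∈ Ideal.span {(X i₀ : MvPolynomial (Fin (n + 1)) K), X i₁})
    (hMB : M ∈ Ideal.span {(X i₃ : MvPolynomial (Fin (n + 1)) K), X i₄})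
    (hNh : N.IsHomogeneous 2) (hMh : M.IsHomogeneous 2)
    (hM : M ∉ Ideal.span (X '' (({i₀, i₁} : Set (Fin (n + 1))) ∪ ↑T)))
    (hN : N ∉ Ideal.span (X '' (({i₃, i₄} : Set (Fin (n + 1))) ∪ ↑T)))
    (hT : T.card + 4 ≤ n) (m : ℕ) :
    𝓗(scrollLimitIdeal T i₀ i₁ i₃ i₄ N M, m) =
      chi (n - 2 - T.card) m + 3 * chi (n - 2 - T.card) ((m : ℤ) - 1) := by
  rw [hilbert_scrollLimitIdeal h₀₁ h₀₃ h₀₄ h₁₃ h₁₄ h₃₄ hi₀ hi₁ hi₃ hi₄ hNA hMB hNh hMh hM hN hT m]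
  obtain ⟨w, hw⟩ : ∃ w, n - 3 - T.card = w := ⟨_, rfl⟩
  rw [hw, show n - 1 - T.card = w + 2 by omega, show n - 2 - T.card = w + 1 by omega]
  exact chi_scroll_limit_identity (by omega) m

end Rem67

/-! ## §7 The printed coordinates: `ℙ^{2k+1}`, `Π₁`, `Π₂` and the tails `x_{k+3}, …` / `x_{k+4}, …` -/

section Printed

variable {K : Type u} [Field K]

local notation "𝓗ₖ(" k' ", " I ", " m ")" =>
  (((finrank K (homogeneousSubmodule (Fin (2 * k' + 2)) K m) - finrank K (idealDegree I m) : ℕ) : ℤ))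

/-- The tail coordinates `x_a, x_{a+1}, …, x_{2k+1}` of `ℙ^{2k+1}` as an index set (Prop. 6.1: `a = k + 3`;
Prop. 6.4 / Remark 6.7: `a = k + 4`). [cite: Kloosterman2025, Prop. 6.1, Prop. 6.4 (proofs)] -/
def tailVars (k a : ℕ) : Finset (Fin (2 * k + 2)) := Finset.univ.filter fun l => a ≤ (l : ℕ)

/-- Membership in the tail. [folklore] -/
private theorem mem_tailVars {k a : ℕ} {l : Fin (2 * k + 2)} : l ∈ tailVars k a ↔ a ≤ (l : ℕ) := by
  simp [tailVars]

/-- The tail `x_a, …, x_{2k+1}` has `2k + 2 − a` coordinates. [folklore] -/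
private theorem card_tailVars (k a : ℕ) : (tailVars k a).card = 2 * k + 2 - a := by
  have h : (tailVars k a).map Fin.valEmbedding = Finset.Ico a (2 * k + 2) := by
    ext l
    simp only [Finset.mem_map, mem_tailVars, Fin.valEmbedding_apply, Finset.mem_Ico]
    constructor
    · rintro ⟨x, hx, rfl⟩
      exact ⟨hx, x.isLt⟩
    · rintro ⟨hal, hl⟩
      exact ⟨⟨l, hl⟩, hal, rfl⟩
  rw [← Finset.card_map Fin.valEmbedding, h, Nat.card_Ico]

/-- A coordinate of index `< a` is not in the tail. [folklore] -/
private theorem mk_notMem_tailVars {k a j : ℕ} (hj : j < 2 * k + 2) (hja : j < a) :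
    (⟨j, hj⟩ : Fin (2 * k + 2)) ∉ tailVars k a := by
  rw [mem_tailVars]
  exact Nat.not_le.mpr hja

/-- **Proposition 6.1 in the printed coordinates** (`k ≥ 1`, `Π₁ = V(x₀, x₁, x_{k+3}, …, x_{2k+1})`,
`Π₂ = V(x₂, x₃, x_{k+3}, …, x_{2k+1})`, `Q₀₃, Q₁₃` quadrics): whenever `I^{(t)} = ⟨x₀x₂ + tQ₁₃, x₁x₂ − tQ₀₃, x_{k+3}, …⟩`
is a complete intersection of multidegree `(2,2,1,…,1)` and the residual piece `V(x₂, x₁Q₁₃ + x₀Q₀₃, x_{k+3}, …)` of `Y_0`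
is one of multidegree `(1,3,1,…,1)`: (a) "the Hilbert functions of `I^{(0)}` and `I^{(t)}` coincide"; (b) their common
value is the Hilbert function `χ_{k+3}(m) − 2χ_{k+3}(m−2) + χ_{k+3}(m−4)` of a complete intersection of multidegree
`(2,2,1^{k−1})` in `ℙ^{2k+1}`, i.e. Kloosterman 2023 eq. (1) for the degrees `(2, 2, 1, …, 1)`.
[cite: Kloosterman2025, Prop. 6.1 (proof)] [cite: Kloosterman2023, §2 eq. (1)] -/
theorem prop_6_1_hilbert_fibre_eq_hilbert_limit {k : ℕ} (hk : 1 ≤ k) (Q₀₃ Q₁₃ : MvPolynomial (Fin (2 * k + 2)) K)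
    (hQ₀₃ : Q₀₃.IsHomogeneous 2) (hQ₁₃ : Q₁₃.IsHomogeneous 2) {t : K}
    (hq₁ : X ⟨0, by omega⟩ * X ⟨2, by omega⟩ + C t * Q₁₃ ∉
      Ideal.span (X '' (tailVars k (k + 3) : Set (Fin (2 * k + 2)))))
    (hq₂ : ∀ u, (X ⟨1, by omega⟩ * X ⟨2, by omega⟩ - C t * Q₀₃) * u ∈
        Ideal.span (X '' (tailVars k (k + 3) : Set (Fin (2 * k + 2)))) ⊔
          Ideal.span {X ⟨0, by omega⟩ * X ⟨2, by omega⟩ + C t * Q₁₃} →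
      u ∈ Ideal.span (X '' (tailVars k (k + 3) : Set (Fin (2 * k + 2)))) ⊔
          Ideal.span {X ⟨0, by omega⟩ * X ⟨2, by omega⟩ + C t * Q₁₃})
    (hL : X ⟨1, by omega⟩ * Q₁₃ + X ⟨0, by omega⟩ * Q₀₃ ∉
      Ideal.span (X '' (({(⟨2, by omega⟩ : Fin (2 * k + 2))} : Set (Fin (2 * k + 2))) ∪ ↑(tailVars k (k + 3)))))
    (m : ℕ) :
    𝓗ₖ(k, quarticFibreIdeal (tailVars k (k + 3)) ⟨0, by omega⟩ ⟨1, by omega⟩ ⟨2, by omega⟩ Q₀₃ Q₁₃ t, m) =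
        𝓗ₖ(k, quarticLimitIdeal (tailVars k (k + 3)) ⟨0, by omega⟩ ⟨1, by omega⟩ ⟨2, by omega⟩ Q₀₃ Q₁₃, m) ∧
      𝓗ₖ(k, quarticFibreIdeal (tailVars k (k + 3)) ⟨0, by omega⟩ ⟨1, by omega⟩ ⟨2, by omega⟩ Q₀₃ Q₁₃ t, m) =
        chi (k + 3) m - 2 * chi (k + 3) ((m : ℤ) - 2) + chi (k + 3) ((m : ℤ) - 4) ∧
      𝓗ₖ(k, quarticFibreIdeal (tailVars k (k + 3)) ⟨0, by omega⟩ ⟨1, by omega⟩ ⟨2, by omega⟩ Q₀₃ Q₁₃ t, m) =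
        koszulHilbert (2 * k + 2) (2 :: 2 :: List.replicate (k - 1) 1) m := by
  have hcard : (tailVars k (k + 3)).card = k - 1 := by rw [card_tailVars]; omega
  have h01 : (⟨0, by omega⟩ : Fin (2 * k + 2)) ≠ ⟨1, by omega⟩ := by simp
  have h02 : (⟨0, by omega⟩ : Fin (2 * k + 2)) ≠ ⟨2, by omega⟩ := by simp
  have h12 : (⟨1, by omega⟩ : Fin (2 * k + 2)) ≠ ⟨2, by omega⟩ := by simp
  have hfib := hilbert_quarticFibreIdeal (n := 2 * k + 1) (T := tailVars k (k + 3)) (i₁ := ⟨1, by omega⟩)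
    hQ₀₃ hQ₁₃ hq₁ hq₂ (by rw [hcard]; omega) m
  rw [hcard, show 2 * k + 1 + 1 - (k - 1) = k + 3 by omega] at hfib
  refine ⟨?_, hfib, ?_⟩
  · exact hilbert_quarticFibreIdeal_eq_hilbert_quarticLimitIdeal (n := 2 * k + 1) h01 h02 h12
      (mk_notMem_tailVars _ (by omega)) (mk_notMem_tailVars _ (by omega)) (mk_notMem_tailVars _ (by omega))
      hQ₀₃ hQ₁₃ hq₁ hq₂ hL (by rw [hcard]; omega) m
  · rw [hfib, show 2 * k + 2 = (k + 3) + (k - 1) by omega,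
      show (2 :: 2 :: List.replicate (k - 1) 1) = [2, 2] ++ List.replicate (k - 1) 1 from rfl,
      koszulHilbert_add_append_replicate_one (by omega), koszulHilbert_two_two]

/-- **The central fibre of Proposition 6.4 in the printed coordinates** (`k ≥ 2`, `Π₁ = V(x₀,x₁,x₂,x_{k+4},…)`,
`Π₂ = V(x₃,x₄,x₅,x_{k+4},…)`, `p₁, p₂ ∈ ⟨x₀,x₁,x₂⟩` the substituted Plücker quadrics): if `⟨x₃, x_{k+4}, …, p₁, p₂⟩` is a
complete intersection, then `h_{I^{(0)}}(m) = χ_{k+1}(m) + 3χ_{k+1}(m−1) + χ_{k+1}(m−2)` — Hilbert series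
`(1 + 3s + s²)/(1 − s)^{k+1}`, that of a `k`-dimensional linear section of the cone over `G(2,5)`.
[cite: Kloosterman2025, Prop. 6.4 (proof)] -/
theorem prop_6_4_hilbert_limit {k : ℕ} (hk : 2 ≤ k) (p₁ p₂ : MvPolynomial (Fin (2 * k + 2)) K)
    (hp₁A : p₁ ∈ Ideal.span {(X ⟨0, by omega⟩ : MvPolynomial (Fin (2 * k + 2)) K), X ⟨1, by omega⟩, X ⟨2, by omega⟩})
    (hp₂A : p₂ ∈ Ideal.span {(X ⟨0, by omega⟩ : MvPolynomial (Fin (2 * k + 2)) K), X ⟨1, by omega⟩, X ⟨2, by omega⟩})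
    (hp₁h : p₁.IsHomogeneous 2) (hp₂h : p₂.IsHomogeneous 2)
    (hp₁ : p₁ ∉ Ideal.span (X '' (({(⟨3, by omega⟩ : Fin (2 * k + 2))} : Set (Fin (2 * k + 2))) ∪
      ↑(tailVars k (k + 4)))))
    (hp₂ : ∀ u, p₂ * u ∈ Ideal.span (X '' (({(⟨3, by omega⟩ : Fin (2 * k + 2))} : Set (Fin (2 * k + 2))) ∪
        ↑(tailVars k (k + 4)))) ⊔ Ideal.span {p₁} →
      u ∈ Ideal.span (X '' (({(⟨3, by omega⟩ : Fin (2 * k + 2))} : Set (Fin (2 * k + 2))) ∪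
        ↑(tailVars k (k + 4)))) ⊔ Ideal.span {p₁})
    (m : ℕ) :
    𝓗ₖ(k, cubicLimitIdeal (tailVars k (k + 4)) ⟨0, by omega⟩ ⟨1, by omega⟩ ⟨2, by omega⟩ ⟨3, by omega⟩ p₁ p₂, m) =
      chi (k + 1) m + 3 * chi (k + 1) ((m : ℤ) - 1) + chi (k + 1) ((m : ℤ) - 2) := by
  have hcard : (tailVars k (k + 4)).card = k - 2 := by rw [card_tailVars]; omega
  have h := hilbert_cubicLimitIdeal_eq_grassmannSection (n := 2 * k + 1) (T := tailVars k (k + 4))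
    (i₀ := ⟨0, by omega⟩) (i₁ := ⟨1, by omega⟩) (i₂ := ⟨2, by omega⟩) (i₃ := ⟨3, by omega⟩)
    (by simp) (by simp) (by simp) (by simp) (by simp) (by simp)
    (mk_notMem_tailVars _ (by omega)) (mk_notMem_tailVars _ (by omega)) (mk_notMem_tailVars _ (by omega))
    (mk_notMem_tailVars _ (by omega)) hp₁A hp₂A hp₁h hp₂h hp₁ hp₂ (by rw [hcard]; omega) m
  rw [hcard, show 2 * k + 1 - 2 - (k - 2) = k + 1 by omega] at h
  exact h

/-- The substituted Plücker quadrics `p₁ = x₀L₀₄ + x₁L₁₄ + x₂L₂₄`, `p₂ = x₀L₀₅ + x₁L₁₅ + x₂L₂₅` of the tree's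
`CubicTwoPlanesDegeneration` lie in `⟨x₀, x₁, x₂⟩` (hypotheses `hp₁A`, `hp₂A` above), for ALL `L_{ij}`.
[cite: Kloosterman2025, Prop. 6.4 (proof)] -/
theorem plucker_subst_mem_span {R : Type*} [CommRing R] (x₀ x₁ x₂ L₀₄ L₀₅ L₁₄ L₁₅ L₂₄ L₂₅ : R) :
    plucker₁ x₀ x₁ L₂₄ x₂ (-L₁₄) L₀₄ ∈ Ideal.span {x₀, x₁, x₂} ∧
      plucker₂ x₀ x₁ L₂₅ x₂ (-L₁₅) L₀₅ ∈ Ideal.span {x₀, x₁, x₂} := by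
  have h := cubicLimitIdeal_le_planeComponent x₀ x₁ x₂ x₀ L₀₄ L₀₅ L₁₄ L₁₅ L₂₄ L₂₅
  exact ⟨h (Ideal.subset_span (by simp)), h (Ideal.subset_span (by simp))⟩

/-- **The central fibre of Remark 6.7 in the printed coordinates** (`k ≥ 2`; `N = x₀L₀₅ + x₁L₁₅ ∈ ⟨x₀,x₁⟩`,
`M = x₃L₂₃ + x₄L₂₄ ∈ ⟨x₃,x₄⟩` quadrics with `M ∉ ⟨x₀, x₁, x_{k+4}, …⟩`, `N ∉ ⟨x₃, x₄, x_{k+4}, …⟩`):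
`h(m) = χ_{k+1}(m) + 3χ_{k+1}(m−1)`, Hilbert series `(1 + 3s)/(1 − s)^{k+1}` of a `k`-dimensional quartic scroll section.
[cite: Kloosterman2025, Remark 6.7] -/
theorem remark_6_7_hilbert_limit {k : ℕ} (hk : 2 ≤ k) (N M : MvPolynomial (Fin (2 * k + 2)) K)
    (hNA : N ∈ Ideal.span {(X ⟨0, by omega⟩ : MvPolynomial (Fin (2 * k + 2)) K), X ⟨1, by omega⟩})
    (hMB : M ∈ Ideal.span {(X ⟨3, by omega⟩ : MvPolynomial (Fin (2 * k + 2)) K), X ⟨4, by omega⟩})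
    (hNh : N.IsHomogeneous 2) (hMh : M.IsHomogeneous 2)
    (hM : M ∉ Ideal.span (X '' (({(⟨0, by omega⟩ : Fin (2 * k + 2)), ⟨1, by omega⟩} : Set (Fin (2 * k + 2))) ∪
      ↑(tailVars k (k + 4)))))
    (hN : N ∉ Ideal.span (X '' (({(⟨3, by omega⟩ : Fin (2 * k + 2)), ⟨4, by omega⟩} : Set (Fin (2 * k + 2))) ∪
      ↑(tailVars k (k + 4)))))
    (m : ℕ) :
    𝓗ₖ(k, scrollLimitIdeal (tailVars k (k + 4)) ⟨0, by omega⟩ ⟨1, by omega⟩ ⟨3, by omega⟩ ⟨4, by omega⟩ N M, m) =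
      chi (k + 1) m + 3 * chi (k + 1) ((m : ℤ) - 1) := by
  have hcard : (tailVars k (k + 4)).card = k - 2 := by rw [card_tailVars]; omega
  have h := hilbert_scrollLimitIdeal_eq_scrollSection (n := 2 * k + 1) (T := tailVars k (k + 4))
    (i₀ := ⟨0, by omega⟩) (i₁ := ⟨1, by omega⟩) (i₃ := ⟨3, by omega⟩) (i₄ := ⟨4, by omega⟩)
    (by simp) (by simp) (by simp) (by simp) (by simp) (by simp)
    (mk_notMem_tailVars _ (by omega)) (mk_notMem_tailVars _ (by omega)) (mk_notMem_tailVars _ (by omega))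
    (mk_notMem_tailVars _ (by omega)) hNA hMB hNh hMh hM hN (by rw [hcard]; omega) m
  rw [hcard, show 2 * k + 1 - 2 - (k - 2) = k + 1 by omega] at h
  exact h

end Printed

/-! ## §8 Checking the hypotheses: quadrics not involving the tail coordinates (`Q_{ij} ∈ ℂ[x₀, …, x_{k+2}]`) -/

section Hypotheses

variable {K : Type u} [Field K] {n : ℕ}

local notation "𝓗(" I ", " m ")" =>
  (((finrank K (homogeneousSubmodule (Fin (n + 1)) K m) - finrank K (idealDegree I m) : ℕ) : ℤ))

-- as in §7: `𝓗ₖ(k, I, m) := dim_K (K[x₀, …, x_{2k+1}] / I)_m`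
local notation "𝓗ₖ(" k' ", " I ", " m ")" =>
  (((finrank K (homogeneousSubmodule (Fin (2 * k' + 2)) K m) - finrank K (idealDegree I m) : ℕ) : ℤ))

variable (s : Set (Fin (n + 1))) [DecidablePred (· ∈ s)]

/-- `killVars s` on a variable (the tree's `killVars`: `x_i ↦ 0` for `i ∈ s`, `x_i ↦ x_i` otherwise). [folklore] -/
private theorem killVars_X_eq (i : Fin (n + 1)) :
    killVars (K := K) s (X i) = if i ∈ s then 0 else X i := by
  rw [killVars, aeval_X]

/-- The kernel of `killVars s` is `(x_i : i ∈ s)` (tree `ker_aeval_ite_eq_span`). [folklore] -/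
private theorem killVars_eq_zero_iff (p : MvPolynomial (Fin (n + 1)) K) :
    killVars s p = 0 ↔ p ∈ Ideal.span (X '' s : Set (MvPolynomial (Fin (n + 1)) K)) := by
  rw [← ker_aeval_ite_eq_span s, RingHom.mem_ker]
  rfl

/-- `killVars s` is idempotent. [folklore] -/
private theorem killVars_killVars_eq (p : MvPolynomial (Fin (n + 1)) K) :
    killVars s (killVars s p) = killVars (K := K) s p := by
  have h : (killVars (K := K) s).comp (killVars s) = killVars s := by
    refine MvPolynomial.algHom_ext fun i => ?_
    rw [AlgHom.comp_apply, killVars_X_eq]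
    split_ifs with hi
    · rw [map_zero]
    · rw [killVars_X_eq, if_neg hi]
  exact congrArg (fun φ : MvPolynomial (Fin (n + 1)) K →ₐ[K] MvPolynomial (Fin (n + 1)) K => φ p) h

/-- `p − p|_{x_s = 0} ∈ (x_i : i ∈ s)`. [folklore] -/
private theorem sub_killVars_mem (p : MvPolynomial (Fin (n + 1)) K) :
    p - killVars s p ∈ Ideal.span (X '' s : Set (MvPolynomial (Fin (n + 1)) K)) := by
  rw [← killVars_eq_zero_iff, map_sub, killVars_killVars_eq, sub_self]

/-- A polynomial not involving the variables of `s` (`vars p ∩ s = ∅`; printed: "`Q_{ij} ∈ ℂ[x₀, …, x_{k+2}]`") is fixed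
by `killVars s`. [folklore] -/
private theorem killVars_eq_self_of_forall_vars {p : MvPolynomial (Fin (n + 1)) K} (hp : ∀ i ∈ p.vars, i ∉ s) :
    killVars s p = p := by
  have h := MvPolynomial.hom_congr_vars (f₁ := (killVars (K := K) s).toRingHom) (f₂ := RingHom.id _)
    (p₁ := p) (p₂ := p) (RingHom.ext fun r => (killVars (K := K) s).commutes r) (fun i hi _ => by
      rw [RingHom.id_apply, AlgHom.toRingHom_eq_coe, AlgHom.coe_toRingHom, killVars_X_eq, if_neg (hp i hi)]) rfl
  simpa using h

variable {s}

/-- A polynomial with non-zero restriction to `{x_s = 0}` does not lie in `(x_i : i ∈ s)`. [folklore] -/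
private theorem notMem_span_X_image_of_killVars_ne_zero {p : MvPolynomial (Fin (n + 1)) K} (hp : killVars s p ≠ 0) :
    p ∉ Ideal.span (X '' s : Set (MvPolynomial (Fin (n + 1)) K)) :=
  fun h => hp ((killVars_eq_zero_iff s p).mpr h)

/-- **Coprime restrictions give a regular sequence**: if the restrictions `q₁|_{x_s=0}, q₂|_{x_s=0}` are relatively prime
(no common non-unit factor in the UFD `K[x]`), then `q₂` is a non-zero-divisor modulo `(x_s) + (q₁)` — i.e. `x_s, q₁, q₂`
is a regular sequence ("`Y_t` is a complete intersection"). [folklore] -/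
private theorem mem_sup_span_of_isRelPrime {q₁ q₂ : MvPolynomial (Fin (n + 1)) K}
    (hcop : IsRelPrime (killVars s q₁) (killVars s q₂)) (u : MvPolynomial (Fin (n + 1)) K)
    (hu : q₂ * u ∈ Ideal.span (X '' s : Set (MvPolynomial (Fin (n + 1)) K)) ⊔ Ideal.span {q₁}) :
    u ∈ Ideal.span (X '' s : Set (MvPolynomial (Fin (n + 1)) K)) ⊔ Ideal.span {q₁} := by
  obtain ⟨z, hz, w, hw, hzw⟩ := Submodule.mem_sup.mp hu
  obtain ⟨a, rfl⟩ := Ideal.mem_span_singleton'.mp hw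
  -- restrict to `{x_s = 0}`: `q₂| · u| = a| · q₁|`
  have hk : killVars s q₂ * killVars s u = killVars s a * killVars s q₁ := by
    have h := congrArg (killVars (K := K) s) hzw
    rw [map_add, (killVars_eq_zero_iff s z).mpr hz, zero_add, map_mul, map_mul] at h
    exact h.symm
  have hdvd : killVars s q₁ ∣ killVars s q₂ * killVars s u := ⟨killVars s a, by rw [hk, mul_comm]⟩
  obtain ⟨b, hb⟩ := hcop.dvd_of_dvd_mul_left hdvd
  have e : u = ((u - killVars s u) - (q₁ - killVars s q₁) * b) + q₁ * b := by rw [hb]; ring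
  rw [e]
  exact Submodule.add_mem_sup
    (Ideal.sub_mem _ (sub_killVars_mem s u) (Ideal.mul_mem_right _ _ (sub_killVars_mem s q₁)))
    (Ideal.mem_span_singleton'.mpr ⟨b, by ring⟩)

/-- **Membership in `(x_i, x_s)` means divisibility by `x_i` after restriction**: for `i ∉ s`, `L ∈ (x_i, x_s)` forces
`x_i ∣ L|_{x_s=0}`; so `x_i ∤ L|_{x_s=0}` gives `L ∉ (x_i, x_s)` (the residual cubic `V(x₂, L, x_T)` has the expected
dimension). [folklore] -/
private theorem notMem_span_X_image_insert_of_not_dvd {L : MvPolynomial (Fin (n + 1)) K} {i : Fin (n + 1)}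
    (hi : i ∉ s) (hdvd : ¬ X i ∣ killVars s L) :
    L ∉ Ideal.span (X '' (({i} : Set (Fin (n + 1))) ∪ s)) := by
  intro hmem
  rw [Set.image_union, Set.image_singleton, Ideal.span_union] at hmem
  obtain ⟨w, hw, z, hz, hwz⟩ := Submodule.mem_sup.mp hmem
  obtain ⟨a, rfl⟩ := Ideal.mem_span_singleton'.mp hw
  have h := congrArg (killVars (K := K) s) hwz
  rw [map_add, (killVars_eq_zero_iff s z).mpr hz, add_zero, map_mul, killVars_X_eq, if_neg hi] at h
  exact hdvd ⟨killVars s a, by rw [← h, mul_comm]⟩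

variable {T : Finset (Fin (n + 1))} {i₀ i₁ i₂ i₃ : Fin (n + 1)} {Q₀₃ Q₁₃ p₁ p₂ : MvPolynomial (Fin (n + 1)) K}

/-- **Prop. 6.1's flatness with the hypotheses in checkable form**: for quadrics `Q₀₃, Q₁₃` not involving the tail
coordinates `x_T` ("`Q_{ij} ∈ ℂ[x₀, …, x_{k+2}]₂`") and a parameter `t` such that `q₁ = x₀x₂ + tQ₁₃ ≠ 0` is relatively
prime to `q₂ = x₁x₂ − tQ₀₃` (so that "`Y_t` is a complete intersection of multidegree `(2,2,1,…,1)`") and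
`x₂ ∤ L = x₁Q₁₃ + x₀Q₀₃`, the Hilbert functions of `I^{(t)}` and `I^{(0)}` coincide.
[cite: Kloosterman2025, Prop. 6.1 (proof)] -/
theorem hilbert_quarticFibreIdeal_eq_hilbert_quarticLimitIdeal_of_isRelPrime {t : K} (h₀₁ : i₀ ≠ i₁) (h₀₂ : i₀ ≠ i₂)
    (h₁₂ : i₁ ≠ i₂) (hi₀ : i₀ ∉ T) (hi₁ : i₁ ∉ T) (hi₂ : i₂ ∉ T) (hQ₀₃ : Q₀₃.IsHomogeneous 2)
    (hQ₁₃ : Q₁₃.IsHomogeneous 2) (hQ₀₃T : ∀ i ∈ Q₀₃.vars, i ∉ T) (hQ₁₃T : ∀ i ∈ Q₁₃.vars, i ∉ T)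
    (hq₁0 : X i₀ * X i₂ + C t * Q₁₃ ≠ 0) (hcop : IsRelPrime (X i₀ * X i₂ + C t * Q₁₃) (X i₁ * X i₂ - C t * Q₀₃))
    (hL : ¬ X i₂ ∣ X i₁ * Q₁₃ + X i₀ * Q₀₃) (hT : T.card + 3 ≤ n) (m : ℕ) :
    𝓗(quarticFibreIdeal T i₀ i₁ i₂ Q₀₃ Q₁₃ t, m) = 𝓗(quarticLimitIdeal T i₀ i₁ i₂ Q₀₃ Q₁₃, m) := by
  have hX : ∀ {i : Fin (n + 1)}, i ∉ T → killVars (K := K) (T : Set (Fin (n + 1))) (X i) = X i :=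
    fun hi => by rw [killVars_X_eq, if_neg (by exact_mod_cast hi)]
  have hC : killVars (K := K) (T : Set (Fin (n + 1))) (C t) = C t := (killVars (K := K) _).commutes t
  have hQ₀₃k : killVars (T : Set (Fin (n + 1))) Q₀₃ = Q₀₃ :=
    killVars_eq_self_of_forall_vars _ fun i hi => by exact_mod_cast hQ₀₃T i hi
  have hQ₁₃k : killVars (T : Set (Fin (n + 1))) Q₁₃ = Q₁₃ :=
    killVars_eq_self_of_forall_vars _ fun i hi => by exact_mod_cast hQ₁₃T i hi
  have hq₁T : killVars (T : Set (Fin (n + 1))) (X i₀ * X i₂ + C t * Q₁₃) = X i₀ * X i₂ + C t * Q₁₃ := by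
    rw [map_add, map_mul, map_mul, hX hi₀, hX hi₂, hC, hQ₁₃k]
  have hq₂T : killVars (T : Set (Fin (n + 1))) (X i₁ * X i₂ - C t * Q₀₃) = X i₁ * X i₂ - C t * Q₀₃ := by
    rw [map_sub, map_mul, map_mul, hX hi₁, hX hi₂, hC, hQ₀₃k]
  have hLT : killVars (T : Set (Fin (n + 1))) (X i₁ * Q₁₃ + X i₀ * Q₀₃) = X i₁ * Q₁₃ + X i₀ * Q₀₃ := by
    rw [map_add, map_mul, map_mul, hX hi₁, hX hi₀, hQ₁₃k, hQ₀₃k]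
  exact hilbert_quarticFibreIdeal_eq_hilbert_quarticLimitIdeal h₀₁ h₀₂ h₁₂ hi₀ hi₁ hi₂ hQ₀₃ hQ₁₃
    (notMem_span_X_image_of_killVars_ne_zero (by rwa [hq₁T]))
    (mem_sup_span_of_isRelPrime (by rwa [hq₁T, hq₂T]))
    (notMem_span_X_image_insert_of_not_dvd (by exact_mod_cast hi₂) (by rwa [hLT])) hT m

/-- **Prop. 6.4's central fibre with the complete-intersection hypothesis in checkable form**: writing `p̄` for the
restriction `p|_{x₃ = x_T = 0}`, if `p̄₁ ≠ 0` and `p̄₁, p̄₂` are relatively prime in the UFD `K[x]` (so that `x_T, x₃, p₁, p₂`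
is a regular sequence: "`⟨p₁, p₂, x₃⟩` is a complete intersection ideal"), then
`h_{I^{(0)}}(m) = χ_w(m) + 3χ_w(m−1) + χ_w(m−2)`, `w = n − 2 − #T`. [cite: Kloosterman2025, Prop. 6.4 (proof)] -/
theorem hilbert_cubicLimitIdeal_eq_grassmannSection_of_isRelPrime (h₀₁ : i₀ ≠ i₁) (h₀₂ : i₀ ≠ i₂) (h₀₃ : i₀ ≠ i₃)
    (h₁₂ : i₁ ≠ i₂) (h₁₃ : i₁ ≠ i₃) (h₂₃ : i₂ ≠ i₃) (hi₀ : i₀ ∉ T) (hi₁ : i₁ ∉ T) (hi₂ : i₂ ∉ T) (hi₃ : i₃ ∉ T)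
    (hp₁A : p₁ ∈ Ideal.span {(X i₀ : MvPolynomial (Fin (n + 1)) K), X i₁, X i₂})
    (hp₂A : p₂ ∈ Ideal.span {(X i₀ : MvPolynomial (Fin (n + 1)) K), X i₁, X i₂})
    (hp₁h : p₁.IsHomogeneous 2) (hp₂h : p₂.IsHomogeneous 2)
    (hp₁0 : killVars (({i₃} : Set (Fin (n + 1))) ∪ ↑T) p₁ ≠ 0)
    (hcop : IsRelPrime (killVars (({i₃} : Set (Fin (n + 1))) ∪ ↑T) p₁)
      (killVars (({i₃} : Set (Fin (n + 1))) ∪ ↑T) p₂))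
    (hT : T.card + 4 ≤ n) (m : ℕ) :
    𝓗(cubicLimitIdeal T i₀ i₁ i₂ i₃ p₁ p₂, m) =
      chi (n - 2 - T.card) m + 3 * chi (n - 2 - T.card) ((m : ℤ) - 1) + chi (n - 2 - T.card) ((m : ℤ) - 2) :=
  hilbert_cubicLimitIdeal_eq_grassmannSection h₀₁ h₀₂ h₀₃ h₁₂ h₁₃ h₂₃ hi₀ hi₁ hi₂ hi₃ hp₁A hp₂A hp₁h hp₂h
    (notMem_span_X_image_of_killVars_ne_zero hp₁0) (mem_sup_span_of_isRelPrime hcop) hT m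

/-- Coordinates of index `≤ k + 2` are not in the tail `x_{k+3}, …, x_{2k+1}`. [folklore] -/
private theorem notMem_tailVars_of_forall_vars {k : ℕ} {Q : MvPolynomial (Fin (2 * k + 2)) K}
    (hQ : ∀ i ∈ Q.vars, (i : ℕ) ≤ k + 2) : ∀ i ∈ Q.vars, i ∉ tailVars k (k + 3) :=
  fun i hi h => absurd ((mem_tailVars).mp h) (by have := hQ i hi; omega)

/-- **Proposition 6.1 in the printed coordinates, hypotheses in checkable form** (`k ≥ 1`; `Q₀₃, Q₁₃ ∈ K[x₀, …, x_{k+2}]₂`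
as printed; `q₁ = x₀x₂ + tQ₁₃ ≠ 0` relatively prime to `q₂ = x₁x₂ − tQ₀₃`, i.e. `Y_t = V(I^{(t)})` "is a complete
intersection of multidegree `(2,2,1,…,1)`"; `x₂ ∤ x₁Q₁₃ + x₀Q₀₃`): the Hilbert functions of `I^{(t)}` and `I^{(0)}`
coincide, and equal `χ_{k+3}(m) − 2χ_{k+3}(m−2) + χ_{k+3}(m−4)`, the Hilbert function of a complete intersection of
multidegree `(2, 2, 1^{k−1})` in `ℙ^{2k+1}`. [cite: Kloosterman2025, Prop. 6.1 (proof)] [cite: Kloosterman2023, §2 eq. (1)] -/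
theorem prop_6_1_hilbert_fibre_eq_hilbert_limit_of_isRelPrime {k : ℕ} (hk : 1 ≤ k)
    (Q₀₃ Q₁₃ : MvPolynomial (Fin (2 * k + 2)) K) (hQ₀₃ : Q₀₃.IsHomogeneous 2) (hQ₁₃ : Q₁₃.IsHomogeneous 2)
    (hQ₀₃v : ∀ i ∈ Q₀₃.vars, (i : ℕ) ≤ k + 2) (hQ₁₃v : ∀ i ∈ Q₁₃.vars, (i : ℕ) ≤ k + 2) {t : K}
    (hq₁0 : X ⟨0, by omega⟩ * X ⟨2, by omega⟩ + C t * Q₁₃ ≠ 0)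
    (hcop : IsRelPrime (X ⟨0, by omega⟩ * X ⟨2, by omega⟩ + C t * Q₁₃) (X ⟨1, by omega⟩ * X ⟨2, by omega⟩ - C t * Q₀₃))
    (hL : ¬ X ⟨2, by omega⟩ ∣ X ⟨1, by omega⟩ * Q₁₃ + X ⟨0, by omega⟩ * Q₀₃) (m : ℕ) :
    𝓗ₖ(k, quarticFibreIdeal (tailVars k (k + 3)) ⟨0, by omega⟩ ⟨1, by omega⟩ ⟨2, by omega⟩ Q₀₃ Q₁₃ t, m) =
        𝓗ₖ(k, quarticLimitIdeal (tailVars k (k + 3)) ⟨0, by omega⟩ ⟨1, by omega⟩ ⟨2, by omega⟩ Q₀₃ Q₁₃, m) ∧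
      𝓗ₖ(k, quarticFibreIdeal (tailVars k (k + 3)) ⟨0, by omega⟩ ⟨1, by omega⟩ ⟨2, by omega⟩ Q₀₃ Q₁₃ t, m) =
        chi (k + 3) m - 2 * chi (k + 3) ((m : ℤ) - 2) + chi (k + 3) ((m : ℤ) - 4) ∧
      𝓗ₖ(k, quarticFibreIdeal (tailVars k (k + 3)) ⟨0, by omega⟩ ⟨1, by omega⟩ ⟨2, by omega⟩ Q₀₃ Q₁₃ t, m) =
        koszulHilbert (2 * k + 2) (2 :: 2 :: List.replicate (k - 1) 1) m := by
  have hT := fun (j : ℕ) (hj : j < 2 * k + 2) (hja : j < k + 3) => mk_notMem_tailVars (k := k) hj hja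
  have hX : ∀ {i : Fin (2 * k + 2)}, i ∉ tailVars k (k + 3) →
      killVars (K := K) (tailVars k (k + 3) : Set (Fin (2 * k + 2))) (X i) = X i :=
    fun hi => by rw [killVars_X_eq (n := 2 * k + 1), if_neg (by exact_mod_cast hi)]
  have hC : killVars (K := K) (tailVars k (k + 3) : Set (Fin (2 * k + 2))) (C t) = C t :=
    (killVars (K := K) _).commutes t
  have hQ₀₃k : killVars (tailVars k (k + 3) : Set (Fin (2 * k + 2))) Q₀₃ = Q₀₃ :=
    killVars_eq_self_of_forall_vars (n := 2 * k + 1) _ fun i hi => by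
      exact_mod_cast notMem_tailVars_of_forall_vars hQ₀₃v i hi
  have hQ₁₃k : killVars (tailVars k (k + 3) : Set (Fin (2 * k + 2))) Q₁₃ = Q₁₃ :=
    killVars_eq_self_of_forall_vars (n := 2 * k + 1) _ fun i hi => by
      exact_mod_cast notMem_tailVars_of_forall_vars hQ₁₃v i hi
  have hq₁T : killVars (tailVars k (k + 3) : Set (Fin (2 * k + 2))) (X ⟨0, by omega⟩ * X ⟨2, by omega⟩ + C t * Q₁₃) =
      X ⟨0, by omega⟩ * X ⟨2, by omega⟩ + C t * Q₁₃ := by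
    rw [map_add, map_mul, map_mul, hX (hT 0 _ (by omega)), hX (hT 2 _ (by omega)), hC, hQ₁₃k]
  have hq₂T : killVars (tailVars k (k + 3) : Set (Fin (2 * k + 2))) (X ⟨1, by omega⟩ * X ⟨2, by omega⟩ - C t * Q₀₃) =
      X ⟨1, by omega⟩ * X ⟨2, by omega⟩ - C t * Q₀₃ := by
    rw [map_sub, map_mul, map_mul, hX (hT 1 _ (by omega)), hX (hT 2 _ (by omega)), hC, hQ₀₃k]
  have hLT : killVars (tailVars k (k + 3) : Set (Fin (2 * k + 2))) (X ⟨1, by omega⟩ * Q₁₃ + X ⟨0, by omega⟩ * Q₀₃) =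
      X ⟨1, by omega⟩ * Q₁₃ + X ⟨0, by omega⟩ * Q₀₃ := by
    rw [map_add, map_mul, map_mul, hX (hT 1 _ (by omega)), hX (hT 0 _ (by omega)), hQ₁₃k, hQ₀₃k]
  exact prop_6_1_hilbert_fibre_eq_hilbert_limit hk Q₀₃ Q₁₃ hQ₀₃ hQ₁₃
    (notMem_span_X_image_of_killVars_ne_zero (n := 2 * k + 1) (by rwa [hq₁T]))
    (mem_sup_span_of_isRelPrime (n := 2 * k + 1) (by rwa [hq₁T, hq₂T]))
    (notMem_span_X_image_insert_of_not_dvd (n := 2 * k + 1) (by exact_mod_cast hT 2 _ (by omega)) (by rwa [hLT])) m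

/-- **The central fibre of Proposition 6.4 in the printed coordinates, complete-intersection hypothesis in checkable
form** (`k ≥ 2`): with `p̄ = p|_{x₃ = x_{k+4} = ⋯ = x_{2k+1} = 0}`, if `p̄₁ ≠ 0` and `p̄₁, p̄₂` are relatively prime, then
`h_{I^{(0)}}(m) = χ_{k+1}(m) + 3χ_{k+1}(m−1) + χ_{k+1}(m−2)` (Hilbert series `(1 + 3s + s²)/(1 − s)^{k+1}`).
[cite: Kloosterman2025, Prop. 6.4 (proof)] -/
theorem prop_6_4_hilbert_limit_of_isRelPrime {k : ℕ} (hk : 2 ≤ k) (p₁ p₂ : MvPolynomial (Fin (2 * k + 2)) K)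
    (hp₁A : p₁ ∈ Ideal.span {(X ⟨0, by omega⟩ : MvPolynomial (Fin (2 * k + 2)) K), X ⟨1, by omega⟩, X ⟨2, by omega⟩})
    (hp₂A : p₂ ∈ Ideal.span {(X ⟨0, by omega⟩ : MvPolynomial (Fin (2 * k + 2)) K), X ⟨1, by omega⟩, X ⟨2, by omega⟩})
    (hp₁h : p₁.IsHomogeneous 2) (hp₂h : p₂.IsHomogeneous 2)
    (hp₁0 : killVars (({(⟨3, by omega⟩ : Fin (2 * k + 2))} : Set (Fin (2 * k + 2))) ∪ ↑(tailVars k (k + 4))) p₁ ≠ 0)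
    (hcop : IsRelPrime
      (killVars (({(⟨3, by omega⟩ : Fin (2 * k + 2))} : Set (Fin (2 * k + 2))) ∪ ↑(tailVars k (k + 4))) p₁)
      (killVars (({(⟨3, by omega⟩ : Fin (2 * k + 2))} : Set (Fin (2 * k + 2))) ∪ ↑(tailVars k (k + 4))) p₂))
    (m : ℕ) :
    𝓗ₖ(k, cubicLimitIdeal (tailVars k (k + 4)) ⟨0, by omega⟩ ⟨1, by omega⟩ ⟨2, by omega⟩ ⟨3, by omega⟩ p₁ p₂, m) =
      chi (k + 1) m + 3 * chi (k + 1) ((m : ℤ) - 1) + chi (k + 1) ((m : ℤ) - 2) :=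
  prop_6_4_hilbert_limit hk p₁ p₂ hp₁A hp₂A hp₁h hp₂h
    (notMem_span_X_image_of_killVars_ne_zero (n := 2 * k + 1) hp₁0)
    (mem_sup_span_of_isRelPrime (n := 2 * k + 1) hcop) m

end Hypotheses

end Literature.AlgebraicGeometry.Kloosterman2025
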